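import Summits.QuantumAdvantage.QuantumAdvantage.Theses.SpinorFlattening
import Summits.QuantumAdvantage.QuantumAdvantage.Theses.CircuitLB
import Literature.Computability.QuantumComplexity.GaussianRank
import Literature.Computability.QuantumComplexity.BQPSubsetPP
import Literature.Computability.QuantumComplexity.ClassicalClassesProofs
import Literature.Computability.Complexity.CircuitClassesUniformProofs
import Literature.Barriers.QuantumAdvantage.NaturalProofs

/-!
# Disproof of `GaussRankPolyImpliesPPoly` (item stmt-QuantumAdvantage-1247) — findings

Crux (route `SpinorFlattening`, rank 4):
`GaussRankPolyImpliesPPoly : GaussRankPolyThesis → BQP ⊆ PPoly` — "polynomial δ-approximate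
fermionic Gaussian rank of the matchgate-magic powers `|M⟩^{⊗t}` (the route's TARGET `X`) implies
`BQP ⊆ P/poly`".

FINDINGS (refuter-cdisprove-stmt-QuantumAdvantage-1247-0, cycle 1, 2026-08-16). Everything below is
sorry-free unless its docstring says NEAR-MISS.

1. `not_crux_iff` — **a refutation of the crux is exactly (the route's target) ∧ (the thesis of the
   closed route `CircuitLB`)**: `¬ GaussRankPolyImpliesPPoly ↔ GaussRankPolyThesis ∧ ClbThesis`, with
   `ClbThesis = ¬ (BQP ⊆ PPoly)`. So a disproof must (a) PROVE `X`, which the route files as "very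
   probably FALSE" and whose negation at `δ = 1/2` is the kill item `NegApproxGaussRankSuperpoly`
   (stmt-1245, line `spectral-mass-flattening` picked, stub `stub_massBound` LANDED), and (b) prove the
   non-uniform circuit lower bound `BQP ⊄ P/poly`.
2. `thesis_false_of_negApprox`, `crux_of_negApprox`, `crux_irrefutable_of_negApprox` — **the kill item
   settles this crux positively (ex falso)**: `NegApproxGaussRankSuperpoly → ¬ GaussRankPolyThesis`,
   hence `→ GaussRankPolyImpliesPPoly` and `→ ¬¬ GaussRankPolyImpliesPPoly`. The moment 1245 lands, 1247
   closes by a 6-line proof (candidate attached as evidence `CruxOfKill.lean`) and its disproof space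
   is EMPTY. Conversely `not_negApprox_of_not_crux`: a disproof of 1247 refutes the kill item.
3. BARRIER REDUCTIONS (proved from DISCHARGED tree theorems `BQP_subset_PP_holds`,
   `PP_subset_PSPACE_holds`, `P_subset_PPoly_holds`): `not_PP_subset_PPoly_of_not_crux`,
   `not_PSPACE_subset_PPoly_of_not_crux`, `P_ne_PSPACE_of_not_crux` — **any disproof of the crux proves
   `PP ⊄ P/poly`, `PSPACE ⊄ P/poly` and `P ≠ PSPACE`** (frontier: `MA_EXP ⊄ P/poly`; `PP ⊄ SIZE(n^k)`
   for fixed `k` only). Natural-proofs barrier (catalogue `Literature.Barriers.QuantumAdvantage.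
   NaturalProofs`, conditional on `HardPRGExist`): the lower-bound half (b) has no natural proof —
   `no_natural_disproof`. Relativization: (b)'s shape `O ↦ BQP^O ⊄ P^O/poly` fails at any
   `PSPACE`-complete oracle (`BQP^A ⊆ PSPACE^A = P^A`), so (b) needs a non-relativizing argument; `X`
   itself is oracle-independent (a statement about explicit vectors in `(ℂ²)^{⊗4t}`).
4. LOAD-BEARING ANALYSIS. The crux has ONE hypothesis, `X`. Dropped: `WithoutThesis := BQP ⊆ PPoly`;
   `withoutThesis_false_iff : ¬ WithoutThesis ↔ ClbThesis` — NOT refutable here (open lower bound,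
   item 3), and not provable either (it is the non-uniform dequantization of BQP). Weakened to the
   TRUE pointwise statement (item 6): the crux becomes `BQP ⊆ PPoly` itself. Strengthened conclusions
   (`BQP ⊆ P`, `BQP ⊆ SIZE(n^k)`): refuting them needs `BQP ⊄ P` resp. a fixed-polynomial circuit
   lower bound for `BQP` — open as well (`PP ⊄ SIZE(n^k)` is known, `BQP` is not). No side of the
   implication is attackable by a counterexample: there is no finite object to exhibit.
5. THE BIT-SIZE GAP of the intended (non-vacuous) proof — recorded for provers and the planner, as
   Lean definitions: `GaussRankPolyThesisNamed` (`X` over the landed API, `Iff.rfl` with the route's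
   inline `let`s: `thesis_iff_named`), `GaussRankPolyUnitThesis` with `thesis_iff_unit` (PROVED:
   normalising the `g_i` is free — `IsGauss` is `ℂ^× · 𝒢`, so the coefficients of `X` are redundant
   until the terms are normalised), `GaussRankPolyBoundedThesis` (unit terms AND `‖a_i‖ ≤ 2^(t^c + c)`),
   `thesis_of_bounded` / `unit_of_bounded` (trivial directions) and the OPEN converse
   `CoefficientReduction := X → bounded-X`: the gap is EXACTLY the coefficient magnitude. The printed simulators (DiasKoenig2024 §2.5:
   "we use the number of elementary arithmetic operations to quantify the time complexity"; §4.1: the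
   decomposition `{(γ_j, d_j)}` "is explicitly provided as an input") work in the real-RAM model on a
   GIVEN decomposition; `P/poly` advice is a poly-length BIT string, so the packaging consumes
   bounded-X, not X: near-degenerate frames of the CONTINUUM dictionary `𝒢_{4t}` carry unbounded
   coefficients, and the generic semialgebraic bound on a solution of `poly(t)` real unknowns of degree `O(t)` is doubly exponential
   in `t`. `not_coefReductionSchema`: the dictionary-free form of coefficient reduction is FALSE
   already in `ℂ²` (dictionary `{e₀, e₀ + ε e₁}`, target `e₁`): any reduction lemma must use the
   geometry of the spinor variety (e.g. that every osculating space of `𝒢_n` at `g` is spanned by the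
   Gaussian — indeed orthonormal Slater — states `c_S g`, tree: `IsGaussian.majorana_mulVec`).
6. NO FINITE-`t` REFUTATION OF `X` (tightness of the quantifier structure): `thesis_at_each_t` — for
   every `t`, `|M⟩^{⊗t}` is an EXACT combination of `2^(t·4)` Gaussian (computational-basis) states —
   and `thesis_truncated` — for every horizon `T`, `X` restricted to `t ≤ T` holds with `c = 2^(T·4)`.
   Any proof of `¬X` (hence any ex-falso proof of this crux) is asymptotic in `t`; any disproof of the
   crux must produce decompositions of polynomial rank for ALL `t` at every constant `δ`, against the
   mass bound `|ι| − dim W ≤ |ι|·‖ψ − φ‖²` already landed for 1245 (`stub_massBound`).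

7. LIVE IDEA CARDS (Ideas/, 2026-08-16): `exfalso-via-kill` = item 2 here (agreed: the item closes by
   `crux_of_negApprox` the moment 1245's stubs land). `grid-stencil-tameness` = the non-vacuous line:
   (BC) bounded-coefficient re-selection for `𝒢_n` via the degree-`⌊n/2⌋` Pfaffian chart + grid
   stencils, then `TamePackaging`. Disprover's reading: (BC) is consistent with everything here
   (`not_coefReductionSchema` only forbids DICTIONARY-FREE reduction; (BC) uses the chart) and is not
   cheaply refutable — for fixed `n` the `2^n` Fock states are a tame exact frame, so a counterexample
   must be an asymptotic family with small wild-coefficient rank and superpolynomial tame rank (a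
   1245-type lower bound sensitive to coefficient size; none in sight; the separated near-dependency
   regime (R') is where it would live). BUT `bounded_false_of_negApprox`: the card's packaging
   antecedent `GaussRankPolyTame` implies `X`, so `TamePackaging` is killed into vacuity by 1245 exactly
   like this crux; only (BC) itself and a dictionary-level (abstract-resource) packaging theorem
   survive the route's expected death.

8. (gen 2, refuter-cdisprove-stmt-QuantumAdvantage-1247-g2-0, 2026-08-16) EXPONENTIAL COEFFICIENTS ARE FORCED
   (§7). `one_sub_le_sqrt_mul_sum_norm`: a `δ`-approximation `Σ aᵢ gᵢ` of a unit `ψ` by vectors of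
   overlap `|⟨ψ,gᵢ⟩|² ≤ F` has `Σ‖aᵢ‖ ≥ (1−δ)/√F` (Cauchy–Schwarz on `QReg n → ℂ`, transported to
   `EuclideanSpace`; `normSq_magicMPow : ‖M^{⊗t}‖² = 1` proved — it is also the third conjunct of 1245's
   `stub_magicInvariant`). `MagicPowFidelityBound` (`F_𝒢(M^{⊗t}) ≤ 2^{-t}`) is PRINTED — CudbyStrelchuk2023
   Lemma 3 + App. 9 (SDP-dual certificate from the quadratic Gaussian constraints; `t = 2` also
   DiasKoenig2024 Thm 5.10) — but not a tree fact (needs the Cartan/Plücker amplitude relations). Modulo it: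
   `polyCoeffThesis_false_of_fidelityBound` — the natural strengthening `GaussRankPolyPolyCoeffThesis` of `X`
   (unit Gaussian terms AND `‖aᵢ‖ ≤ t^c + c`) is FALSE (at `δ = 1/2`: `2^{t/2}/2 ≤ Σ‖aᵢ‖ ≤ (t^c+c)²`); so any
   decomposition `X` could supply has `max ‖aᵢ‖ ≥ 2^{t/2}/(2r)`: cancellation at scale `2^{-Θ(t)}` and `Θ(t)`
   bits per amplitude are the floor of every packaging (consistent with bounded-`X`'s `2^(t^c+c)` allowance,
   which therefore cannot be lowered to `poly(t)`). STATE OF THE KILL (read 2026-08-16 from crux 1245's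
   PICKED.md / Lines/spectral-mass-flattening.lean): the Bessel mass bound (LANDED) + deficiency + flat
   orthonormality give `‖M^{⊗t} − φ‖² ≥ 1 − r·D_K(4t)/(C(t,K)8^K)` for EVERY `r`-term Gaussian combination —
   an exponential constant-`δ` rank lower bound (`≈ (1−δ²)·2^{0.3326 t}`) modulo 5 registered stubs; when it
   lands, `X`, bounded-`X`, poly-coefficient-`X` and `CoefficientReduction`'s antecedent all die together and
   this crux closes by `crux_of_negApprox`. Numerics filed: kit j009246 (max Gaussian fidelity of `M^{⊗t}`,
   `t ≤ 3`, and the "corner lemma" `‖P₀g‖ + ‖P₁g‖ ≤ ‖g‖` that would give an elementary inductive proof of the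
   fidelity bound).

9. (gen 2) THE ANNIHILATOR OVERLAP BOUND (§8, sorry-free, general `n`): `overlap_bound_of_annihilator` — if
   `L g = 0` and `LLᴴ + LᴴL = 2ν·1` then `2ν|⟨g,ψ⟩|² ≤ ‖g‖²(2ν‖ψ‖² − ‖Lψ‖²)` for EVERY `ψ` (one canonical
   mode `b = L/√(2ν)` with `g` in its kernel: `|⟨g,ψ⟩|² ≤ ‖g‖²(‖ψ‖² − ‖bψ‖²)`); `majoranaComb_car` —
   `c(u)c(u)ᴴ + c(u)ᴴc(u) = 2Σ|u_p|²·1` for any Majorana combination; `gaussian_overlap_sq_le_half_of_cov` —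
   a vector with VANISHING COVARIANCE (`⟨ψ, c_p c_q ψ⟩ = δ_pq‖ψ‖²`) has Gaussian fidelity `≤ 1/2`
   (unconditional in the hypothesis; for `ψ = M^{⊗t}`, `t ≥ 1`, the covariance hypothesis is the `K = 1`
   instance of 1245's `stub_flatOrthoOfInvariant` + the LANDED `stub_magicInvariant`, so `F_𝒢(M^{⊗t}) ≤ 1/2`
   — tight at `t = 1` — follows the moment that stub lands; the printed `2^{-t}` needs more than one
   annihilator and is NOT reachable this way: with all `4t` orthonormalised annihilators the bound
   `|⟨g,ψ⟩|² ≤ ‖g‖²⟨ψ, Π_{i∈S} b_i b_iᴴ ψ⟩` is an identity at `S = [4t]` and for `|S| ≥ 2` involves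
   higher correlators of `ψ` that do not vanish).

10. (gen 2) **`MagicPowFidelityBound` IS NOW A THEOREM** (§9–§10, sorry-free, standard axioms;
   `magicPowFidelityBound_holds`, hence `polyCoeffThesis_false : ¬ GaussRankPolyPolyCoeffThesis`
   UNCONDITIONALLY). New elementary proof of CudbyStrelchuk2023 Lemma 3 from the annihilator definition:
   (i) `isGaussian_quadRel` — the quadratic relations `Σ_p (c_pG)(u)(c_pG)(v) = 0` (`Λ(G⊗G) = 0`): the
   annihilator rows are isotropic and independent, so their span is its own orthogonal (rank–nullity), the
   vector `p ↦ (c_pG)(v)` is orthogonal to every row, hence in the span, hence killed by `p ↦ (c_pG)(u)`;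
   (ii) `majorana_mulVec_apply` + last-block register splitting; the relations are HEREDITARY under
   conditioning on the last block (`quadRel_cond4`, free); (iii) `corner_lemma`: for every `G` on `b+4`
   wires with the relations, `‖G(·,0000)‖ + ‖G(·,1111)‖ ≤ ‖G‖` — the relation at `(w·1000, w'·0111)` reads
   `2(K₀ − K₁ + K₂ − K₃) = −Λ_B(φ ⊗ φ')` in `B ⊗ B` (`Kᵢ` the rank-one corner/even-mid-pair tensors,
   `φ, φ'` the odd conditionals at `1000, 0111`); pairing with the sign-twisted `ā ⊗ b̄` and the CAR bound
   `|Σ_q⟨a,c_qφ⟩⟨b,c_qφ'⟩| ≤ 2‖a‖‖b‖‖φ‖‖φ'‖` (`majorana_bilinear_bound`) give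
   `‖a‖‖b‖ ≤ Σ_{even mid pairs}‖x‖‖x̄‖ + ‖φ‖‖φ'‖ ≤ ½(‖G‖² − ‖a‖² − ‖b‖²)`; (iv) induction on `t` peeling the
   last block (`star_tensorVec_magicM_dotProduct`, `magicMPow_overlap_le`). NUMERICS that found the route
   (local pure python, Pfaffian chart, 640 restarts): corner sup = 1, `F(M⊗M)` max = 1/4, and the stronger
   conjecture `‖P₀g‖‖P₁₅g‖ ≤ Σ_{3 even mid pairs}‖P_ag‖‖P_āg‖` (sup of difference `0`, TIGHT — not needed for
   the proof, recorded as open). LANDING: five files `Theorems/GaussRankPolyImpliesPPoly/Negative/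
   {MajoranaAction (defs), MajoranaCAR, QuadraticRelations, CornerLemma, GaussianFidelity}.lean`
   (400-line lint), proposed in dependency order.

11. (gen 2, 04:15Z) **THE TARGET `X` IS REFUTED IN-TREE AND THE ROUTE IS BROKEN.** The kill item 1245 landed
   (`SpinorFlattening.NegApproxGaussRankSuperpoly_of`, 02:36Z); this seat composed it with
   `Negative.GaussRankPolyThesis_false_of_negApprox` into
   `Theorems/SpinorFlatteningGaussRankPolyThesisRefutation.lean :
   SpinorFlatteningGaussRankPolyThesis_refuted : ¬ GaussRankPolyThesis` (p77980, commit 1fc1f4666c4c;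
   item 1244 closed `refuted`, route BROKEN since 04:14:45Z). Hence THIS crux holds ex falso: complete proof
   `GaussRankPolyImpliesPPoly_holds` attached as evidence `CruxProof.lean` (a prover lands it; refuters do not
   land positive Theses statements). LANDED negative-lemma files of this seat under
   `Theorems/GaussRankPolyImpliesPPoly/Negative/`: `ExponentialCoefficients` (p75434), `MajoranaCAR` (p77892),
   `MajoranaAction` (p77929), `QuadraticRelations` (p78133), `CornerLemma` (p78166), `GaussianFidelity`
   (resubmitted as p82275 after a gate restart): the Gaussian fidelity theorem `F_𝒢(M^{⊗t}) ≤ 2^{-t}` and the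
   unconditional `not_polyCoeffThesis`. FARM NUMERICS kit j009246 (state-vector Riemannian ascent on the full
   Gaussian manifold, both parities; CAR error 0): max Gaussian fidelity of `M^{⊗t}` = 0.5 / 0.25 / 0.125 for
   `t = 1, 2, 3` (= `2^{-t}`, the theorem is tight), corner sup = 1.0 at `n = 8` and `n = 12`.

WHY THE CRUX RESISTS DISPROOF (one line): `¬crux = X ∧ BQP ⊄ P/poly`; `X` is expected false (and is
refuted at every `t`-dependent precision by the flattening bound, at constant precision by the
picked mass-bound line of 1245), and `BQP ⊄ P/poly ⟹ PSPACE ⊄ P/poly` is a frontier-open,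
natural-proofs-barred, non-relativizing circuit lower bound. Expected fate of 1247: closed `proved`
ex falso through 1245 (`crux_of_negApprox`), carrying no information about matchgate simulation; a
NON-vacuous packaging theorem would have to be stated over a free-standing, bit-bounded rank
hypothesis (item 5) — and even "δ-rank of `M^{⊗k}` ≤ q(k)" as a free-standing antecedent is vacuous
once 1245 lands; only a dictionary-level simulation theorem (Literature, DiasKoenig2024 Thm 3.2/§4.1
with bit complexity) is immune.
-/

set_option linter.dupNamespace false

noncomputable section

namespace Summit.QuantumAdvantage.QuantumAdvantage.Cruxes.GaussRankPolyImpliesPPoly.Disproof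

open Literature.Computability.Complexity Literature.Computability.Complexity.Classes
open Literature.Computability.Cryptography Literature.Computability.QuantumComplexity
open Literature.Computability.MetaComplexity (CombinatorialProperty)
open Summit.QuantumAdvantage.QuantumAdvantage.Theses.SpinorFlattening
open Summit.QuantumAdvantage.QuantumAdvantage.Theses.CircuitLB (ClbThesis)
open Matrix

/-! ## §1 Propositional anatomy of the crux -/

/-- The conclusion alone gives the crux. [folklore] -/
theorem crux_of_incl (h : BQP ⊆ PPoly) : GaussRankPolyImpliesPPoly := fun _ => h

/-- The negation of the antecedent (the route's target `X`) gives the crux ex falso. [folklore] -/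
theorem crux_of_not_thesis (h : ¬ GaussRankPolyThesis) : GaussRankPolyImpliesPPoly :=
  fun hX => absurd hX h

/-- `crux ↔ (¬X ∨ BQP ⊆ P/poly)`. [folklore] -/
theorem crux_iff : GaussRankPolyImpliesPPoly ↔ (¬ GaussRankPolyThesis ∨ BQP ⊆ PPoly) := by
  constructor
  · intro h
    by_cases hX : GaussRankPolyThesis
    · exact Or.inr (h hX)
    · exact Or.inl hX
  · rintro (h | h)
    exacts [crux_of_not_thesis h, crux_of_incl h]

/-- **Refuting the crux = proving the route's target AND the thesis of route `CircuitLB`.**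
`ClbThesis` is literally `¬ (BQP ⊆ PPoly)` (route CircuitLB, closed/superseded; natural-proofs
barred, implies `PSPACE ⊄ P/poly`). [folklore] -/
theorem not_crux_iff : ¬ GaussRankPolyImpliesPPoly ↔ (GaussRankPolyThesis ∧ ClbThesis) := by
  rw [crux_iff, not_or, not_not]
  rfl

/-- A disproof of the crux exhibits a `BQP` language without polynomial-size circuits. [folklore] -/
theorem witness_of_not_crux (h : ¬ GaussRankPolyImpliesPPoly) : ∃ L ∈ BQP, L ∉ PPoly := by
  obtain ⟨-, hclb⟩ := not_crux_iff.1 h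
  by_contra hno
  push Not at hno
  exact hclb fun L hL => hno L hL

/-- A disproof of the crux separates `BQP` from `P/poly`. [folklore] -/
theorem not_BQP_subset_PPoly_of_not_crux (h : ¬ GaussRankPolyImpliesPPoly) : ¬ (BQP ⊆ PPoly) :=
  (not_crux_iff.1 h).2

/-- A disproof of the crux PROVES the route's target `X` (which the route expects to refute).
(Positive conclusion on a Theses decl: this lemma stays in the work file.) [folklore] -/
theorem thesis_of_not_crux (h : ¬ GaussRankPolyImpliesPPoly) : GaussRankPolyThesis :=
  (not_crux_iff.1 h).1

/-! ## §2 The kill item settles the crux (ex falso) — the disproof space is empty given 1245 -/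

/-- **Kill wiring**: the kill item `NegApproxGaussRankSuperpoly` (stmt-1245: some constant
`δ ∈ (0,1)` has superpolynomial `δ`-approximate Gaussian rank) refutes the target `X` (stmt-1244).
The three inline `let`s of the two items are syntactically identical, so the instances unify.
[folklore] -/
theorem thesis_false_of_negApprox (h : NegApproxGaussRankSuperpoly) : ¬ GaussRankPolyThesis := by
  intro hX
  obtain ⟨δ, hδ0, -, hall⟩ := h
  obtain ⟨c, hc⟩ := hX δ hδ0
  obtain ⟨t, ht⟩ := hall c
  obtain ⟨r, hr, a, g, hg, hle⟩ := hc t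
  exact absurd hle (not_le.2 (ht r hr a g hg))

/-- **The crux follows from the kill item** (6 lines; candidate proof for provers once 1245 lands).
[folklore] -/
theorem crux_of_negApprox (h : NegApproxGaussRankSuperpoly) : GaussRankPolyImpliesPPoly :=
  crux_of_not_thesis (thesis_false_of_negApprox h)

/-- **Given the kill item the crux is irrefutable.** [folklore] -/
theorem crux_irrefutable_of_negApprox (h : NegApproxGaussRankSuperpoly) :
    ¬ ¬ GaussRankPolyImpliesPPoly :=
  fun hn => hn (crux_of_negApprox h)

/-- Contrapositive: a disproof of this crux REFUTES the kill item 1245 (and with it the picked line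
`spectral-mass-flattening`). [folklore] -/
theorem not_negApprox_of_not_crux (h : ¬ GaussRankPolyImpliesPPoly) : ¬ NegApproxGaussRankSuperpoly :=
  fun hk => crux_irrefutable_of_negApprox hk h

/-! ## §3 Barrier reductions: what a disproof would prove in classical complexity -/

/-- **A disproof of the crux proves `PP ⊄ P/poly`** (through the DISCHARGED tree theorem
`BQP ⊆ PP`, Adleman–DeMarrais–Huang). [cite: AdlemanDeMarraisHuang1997, Thm. 6.4] -/
theorem not_PP_subset_PPoly_of_not_crux (h : ¬ GaussRankPolyImpliesPPoly) : ¬ (PP ⊆ PPoly) :=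
  fun hPP => not_BQP_subset_PPoly_of_not_crux h (fun _ hL => hPP (BQP_subset_PP_holds hL))

/-- **A disproof of the crux proves `PSPACE ⊄ P/poly`** (through the discharged `BQP ⊆ PP ⊆ PSPACE`).
Frontier: `MA_EXP ⊄ P/poly` (Buhrman–Fortnow–Thierauf); `PSPACE ⊄ P/poly` is open.
[cite: AroraBarak2009, §6.1] -/
theorem not_PSPACE_subset_PPoly_of_not_crux (h : ¬ GaussRankPolyImpliesPPoly) : ¬ (PSPACE ⊆ PPoly) :=
  fun hPS => not_PP_subset_PPoly_of_not_crux h (fun _ hL => hPS (PP_subset_PSPACE_holds hL))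

/-- **A disproof of the crux proves `P ≠ PSPACE`** (through the discharged `P ⊆ P/poly`).
[cite: AroraBarak2009, Thm. 6.6] -/
theorem P_ne_PSPACE_of_not_crux (h : ¬ GaussRankPolyImpliesPPoly) : P ≠ PSPACE := by
  intro hP
  apply not_PSPACE_subset_PPoly_of_not_crux h
  rw [← hP]
  exact P_subset_PPoly_holds

/-- **Natural-proofs reading** (catalogue `Literature.Barriers.QuantumAdvantage.NaturalProofs`, i.e.
Razborov–Rudich Thm. 4.1, conditional on `HardPRGExist`): the lower-bound half of any disproof —
`BQP ⊄ P/poly` — cannot be a natural proof (`IsNaturalProofBQPNotPPoly`: a `P/poly`-natural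
property useful against `P/poly` containing the slices of a `BQP` language infinitely often).
[cite: RazborovRudich1997, Thm. 4.1] -/
theorem no_natural_disproof (hNP : Literature.Barriers.QuantumAdvantage.NaturalProofs)
    (hG : Literature.Barriers.PneNP.HardPRGExist) :
    ¬ ∃ P : CombinatorialProperty, IsNaturalProofBQPNotPPoly P :=
  Literature.Barriers.QuantumAdvantage.NaturalProofs.no_naturalProof_bqp_not_ppoly hNP hG

/-! ## §4 Load-bearing analysis: the single hypothesis `X` -/

/-- The crux with its hypothesis `X` DROPPED: the bare non-uniform dequantization `BQP ⊆ P/poly`.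
[folklore] -/
def WithoutThesis : Prop := BQP ⊆ PPoly

/-- Dropping `X` leaves exactly `BQP ⊆ P/poly`; the crux is `X → WithoutThesis`. [folklore] -/
theorem crux_eq_imp : GaussRankPolyImpliesPPoly = (GaussRankPolyThesis → WithoutThesis) := rfl

/-- `WithoutThesis` is NOT refutable cheaply: its negation is literally route CircuitLB's thesis
`ClbThesis` (an open circuit lower bound, §3); so no `_false_without_X` theorem can exist short of
`PSPACE ⊄ P/poly`. Recorded as the equivalence. [folklore] -/
theorem not_withoutThesis_iff : ¬ WithoutThesis ↔ ClbThesis := Iff.rfl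

/-- … and it is not provable cheaply either: `WithoutThesis` gives the crux outright (so a proof of
the dropped-hypothesis form is a proof of non-uniform dequantization of all of `BQP`). [folklore] -/
theorem crux_of_withoutThesis (h : WithoutThesis) : GaussRankPolyImpliesPPoly := crux_of_incl h

/-! ## §5 The honest (bit-bounded) antecedent and the coefficient-reduction gap -/

/-- `X` restated over the landed API (`IsGaussian`, `magicMPow`, `normSq`). [folklore] -/
def GaussRankPolyThesisNamed : Prop :=
  ∀ δ : ℝ, 0 < δ → ∃ c : ℕ, ∀ t : ℕ, ∃ r : ℕ, r ≤ t ^ c + c ∧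
    ∃ (a : Fin r → ℂ) (g : Fin r → QReg (t * 4) → ℂ),
      (∀ i, IsGaussian (g i)) ∧ normSq (magicMPow t - ∑ i, a i • g i) ≤ δ ^ 2

/-- The route's inline `let`s are definitionally the landed API: `X ↔ X_named` by `Iff.rfl`.
[folklore] -/
theorem thesis_iff_named : GaussRankPolyThesis ↔ GaussRankPolyThesisNamed := Iff.rfl

/-- Squared distance dominates one squared amplitude. [folklore] -/
theorem norm_sq_apply_le_normSq {n : ℕ} (f : QReg n → ℂ) (x : QReg n) : ‖f x‖ ^ 2 ≤ normSq f :=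
  Finset.single_le_sum (f := fun y => ‖f y‖ ^ 2) (fun _ _ => by positivity) (Finset.mem_univ x)

/-- `normSq (c • ψ) = ‖c‖² · normSq ψ`. [folklore] -/
theorem normSq_smul {n : ℕ} (c : ℂ) (ψ : QReg n → ℂ) : normSq (c • ψ) = ‖c‖ ^ 2 * normSq ψ := by
  simp [normSq, mul_pow, Finset.mul_sum]

/-- A nonzero vector has positive `normSq`. [folklore] -/
theorem normSq_pos_of_ne_zero {n : ℕ} {ψ : QReg n → ℂ} (h : ψ ≠ 0) : 0 < normSq ψ := by
  obtain ⟨x, hx⟩ : ∃ x, ψ x ≠ 0 := by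
    by_contra hno
    push Not at hno
    exact h (funext hno)
  exact lt_of_lt_of_le (by positivity) (norm_sq_apply_le_normSq ψ x)

/-- **Unit `X`**: the same statement with UNIT Gaussian terms (`normSq (g i) = 1`). [folklore] -/
def GaussRankPolyUnitThesis : Prop :=
  ∀ δ : ℝ, 0 < δ → ∃ c : ℕ, ∀ t : ℕ, ∃ r : ℕ, r ≤ t ^ c + c ∧
    ∃ (a : Fin r → ℂ) (g : Fin r → QReg (t * 4) → ℂ),
      (∀ i, IsGaussian (g i) ∧ normSq (g i) = 1) ∧ normSq (magicMPow t - ∑ i, a i • g i) ≤ δ ^ 2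

/-- **Normalisation is free**: `X ↔ unit-X` (rescale each Gaussian term into its coefficient;
`IsGaussian` is stable under nonzero scalars). So of the two extra clauses of bounded-`X` exactly ONE —
the coefficient magnitude — is the gap. [folklore] -/
theorem thesis_iff_unit : GaussRankPolyThesis ↔ GaussRankPolyUnitThesis := by
  rw [thesis_iff_named]
  constructor
  · intro h δ hδ
    obtain ⟨c, hc⟩ := h δ hδ
    refine ⟨c, fun t => ?_⟩
    obtain ⟨r, hr, a, g, hg, hle⟩ := hc t
    -- rescale: s i = √(normSq (g i)) > 0
    let s : Fin r → ℝ := fun i => Real.sqrt (normSq (g i))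
    have hs : ∀ i, 0 < s i := fun i => Real.sqrt_pos.2 (normSq_pos_of_ne_zero (hg i).ne_zero)
    have hsC : ∀ i, (s i : ℂ) ≠ 0 := fun i => Complex.ofReal_ne_zero.2 (hs i).ne'
    refine ⟨r, hr, fun i => a i * (s i : ℂ), fun i => ((s i : ℂ)⁻¹) • g i, fun i => ⟨?_, ?_⟩, ?_⟩
    · exact (hg i).smul (inv_ne_zero (hsC i))
    · rw [normSq_smul, norm_inv, Complex.norm_real, Real.norm_eq_abs, abs_of_pos (hs i), inv_pow,
        Real.sq_sqrt (le_of_lt (normSq_pos_of_ne_zero (hg i).ne_zero)),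
        inv_mul_cancel₀ (normSq_pos_of_ne_zero (hg i).ne_zero).ne']
    · have : (∑ i, (a i * (s i : ℂ)) • ((s i : ℂ)⁻¹ • g i)) = ∑ i, a i • g i := by
        refine Finset.sum_congr rfl fun i _ => ?_
        rw [smul_smul, mul_assoc, mul_inv_cancel₀ (hsC i), mul_one]
      rw [this]
      exact hle
  · intro h δ hδ
    obtain ⟨c, hc⟩ := h δ hδ
    refine ⟨c, fun t => ?_⟩
    obtain ⟨r, hr, a, g, hg, hle⟩ := hc t
    exact ⟨r, hr, a, g, fun i => (hg i).1, hle⟩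

/-- **Bounded `X`** — what the `P/poly` packaging actually consumes: the same polynomial rank, with
UNIT Gaussian terms and coefficients of bit-size `poly(t)` (`‖a i‖ ≤ 2^(t^c + c)`); with this,
rounding each `g i` to a `poly(t)`-bit Gaussian description (covariance matrix / Givens word)
inside the `δ` budget is routine (`r · 2^(t^c+c) · 2^{-bits} ≤ δ/2`). [cite: DiasKoenig2024, §4.1] -/
def GaussRankPolyBoundedThesis : Prop :=
  ∀ δ : ℝ, 0 < δ → ∃ c : ℕ, ∀ t : ℕ, ∃ r : ℕ, r ≤ t ^ c + c ∧
    ∃ (a : Fin r → ℂ) (g : Fin r → QReg (t * 4) → ℂ),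
      (∀ i, IsGaussian (g i) ∧ normSq (g i) = 1 ∧ ‖a i‖ ≤ 2 ^ (t ^ c + c)) ∧
        normSq (magicMPow t - ∑ i, a i • g i) ≤ δ ^ 2

/-- Bounded `X` implies `X` (forget the bounds). [folklore] -/
theorem thesis_of_bounded (h : GaussRankPolyBoundedThesis) : GaussRankPolyThesis := by
  rw [thesis_iff_named]
  intro δ hδ
  obtain ⟨c, hc⟩ := h δ hδ
  refine ⟨c, fun t => ?_⟩
  obtain ⟨r, hr, a, g, hg, hle⟩ := hc t
  exact ⟨r, hr, a, g, fun i => (hg i).1, hle⟩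

/-- Bounded `X` implies unit `X`. [folklore] -/
theorem unit_of_bounded (h : GaussRankPolyBoundedThesis) : GaussRankPolyUnitThesis := by
  intro δ hδ
  obtain ⟨c, hc⟩ := h δ hδ
  refine ⟨c, fun t => ?_⟩
  obtain ⟨r, hr, a, g, hg, hle⟩ := hc t
  exact ⟨r, hr, a, g, fun i => ⟨(hg i).1, (hg i).2.1⟩, hle⟩

/-- **The kill item also kills bounded/tame `X`** — addressed to crux idea `grid-stencil-tameness`
(Ideas/grid-stencil-tameness.md, 2026-08-16): its packaging half `TamePackaging := GaussRankPolyTame →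
BQP ⊆ PPoly` has the antecedent `GaussRankPolyTame` = (up to the literal form of the coefficient bound)
`GaussRankPolyBoundedThesis`, which IMPLIES `X`; so once `NegApproxGaussRankSuperpoly` (1245) lands,
`TamePackaging` is exactly as vacuous as this crux — it is NOT "meaningful whatever X's fate". A
packaging statement immune to 1245 must quantify over an ABSTRACT resource (any family of gadget states
with tame polynomial approximate Gaussian rank), i.e. be the dictionary-level simulation theorem, not a
statement about `|M⟩^{⊗t}`. [folklore] -/
theorem bounded_false_of_negApprox (h : NegApproxGaussRankSuperpoly) : ¬ GaussRankPolyBoundedThesis :=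
  fun hb => thesis_false_of_negApprox h (thesis_of_bounded hb)

/-- OPEN (the gap, as a `Prop`; no claim made): **coefficient reduction for the Gaussian dictionary**
— does polynomial approximate Gaussian rank with arbitrary complex data imply the bit-bounded form?
Nothing in print: the simulators take the decomposition as real-RAM input (DiasKoenig2024 §2.5, §4.1);
the stabilizer twin needs no such lemma (finite dictionary with `ℚ(ζ₈)` data: optimal coefficients in
a fixed span are `G⁺b`, of polynomial height); for `𝒢_n` the generic semialgebraic witness bound is
doubly exponential. Plausible handle: every osculating space of `𝒢_n` at `g` is spanned by the
Gaussian states `c_S g` (`IsGaussian.majorana_mulVec`), so a degenerating cluster of `k` terms can be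
traded for `≤ Σ_{j<k} C(2n, 2j)` bounded terms — polynomial only for bounded cluster depth.
[folklore] -/
def CoefficientReduction : Prop := GaussRankPolyThesis → GaussRankPolyBoundedThesis

/-! ### The dictionary-free coefficient-reduction schema is false (toy model in `ℂ²`)

`QReg 1 → ℂ` is `ℂ²` with basis `e₀ = |0⟩`, `e₁ = |1⟩`. Dictionary `D_ε = {e₀, e₀ + ε e₁}`
(`normSq ≤ 2` for `ε ≤ 1`), unit target `e₁ = ε⁻¹ • ((e₀ + ε e₁) − e₀)`: EXACT 2-term rank with
coefficients `± ε⁻¹`, while every combination of `D_ε`-elements with at most `N` terms and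
coefficients `≤ B` is `α e₀ + β (e₀ + ε e₁)` with `‖β‖ ≤ N B`, at squared distance
`≥ (1 − N B ε)²` from `e₁`. Choosing `ε = 1/(2 N B)` (after `N, B`) kills any uniform bound. -/

/-- The dictionary-free schema: uniform `N, B` such that exact 2-term representability over ANY
dictionary of vectors of `normSq ≤ 2` in `ℂ²` implies `(1/4)`-approximate representability
(`normSq ≤ 1/16`) with `≤ N` terms and coefficients `≤ B`. [folklore] -/
def CoefReductionSchema : Prop :=
  ∃ (N : ℕ) (B : ℝ), ∀ (D : (QReg 1 → ℂ) → Prop) (ψ : QReg 1 → ℂ),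
    normSq ψ = 1 → (∀ d, D d → normSq d ≤ 2) →
    (∃ (a : Fin 2 → ℂ) (g : Fin 2 → QReg 1 → ℂ), (∀ i, D (g i)) ∧ ψ = ∑ i, a i • g i) →
    ∃ (r : ℕ) (a : Fin r → ℂ) (g : Fin r → QReg 1 → ℂ), r ≤ N ∧ (∀ i, D (g i)) ∧
      (∀ i, ‖a i‖ ≤ B) ∧ normSq (ψ - ∑ i, a i • g i) ≤ 1 / 16

/-- **The dictionary-free schema is FALSE** (toy model in `ℂ² = QReg 1 → ℂ`; see the section
docstring): coefficient reduction, if true for `𝒢_n`, must use the geometry of the spinor variety.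
[folklore] -/
theorem not_coefReductionSchema : ¬ CoefReductionSchema := by
  rintro ⟨N, B, h⟩
  -- the two basis vectors and the squeezed dictionary element
  let x0 : QReg 1 := fun _ => false
  let x1 : QReg 1 := fun _ => true
  have hx : x1 ≠ x0 := fun hx => Bool.noConfusion (congrFun hx 0)
  let e0 : QReg 1 → ℂ := basisState x0
  let e1 : QReg 1 → ℂ := basisState x1
  let B' : ℝ := max B 1
  have hB' : 1 ≤ B' := le_max_right _ _
  have hBB' : B ≤ B' := le_max_left _ _
  let ε : ℝ := 1 / (2 * ((N : ℝ) + 1) * B')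
  have hε0 : 0 < ε := by positivity
  have hε1 : ε ≤ 1 := by
    rw [div_le_one (by positivity)]
    nlinarith [(Nat.cast_nonneg N : (0 : ℝ) ≤ N)]
  let v : QReg 1 → ℂ := e0 + (ε : ℂ) • e1
  let D : (QReg 1 → ℂ) → Prop := fun d => d = e0 ∨ d = v
  -- pointwise values
  have he0x1 : e0 x1 = 0 := by simp [e0, basisState_apply, hx]
  have he1x1 : e1 x1 = 1 := by simp [e1, basisState_apply]
  have hvx1 : v x1 = ε := by simp [v, he0x1, he1x1]
  -- the hypotheses of the schema
  have hψ : normSq e1 = 1 := normSq_basisState x1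
  have hD : ∀ d, D d → normSq d ≤ 2 := by
    rintro d (rfl | rfl)
    · rw [normSq_basisState]; norm_num
    · -- normSq (e0 + ε e1) = 1 + ε² ≤ 2
      have : normSq v = ‖v x0‖ ^ 2 + ‖v x1‖ ^ 2 := by
        rw [normSq, Fintype.sum_eq_add x0 x1 hx.symm]
        rintro y ⟨hy0, hy1⟩
        exfalso
        rcases Bool.eq_false_or_eq_true (y 0) with hy | hy
        · exact hy1 (funext fun i => by rw [Subsingleton.elim i 0, hy])
        · exact hy0 (funext fun i => by rw [Subsingleton.elim i 0, hy])
      have hvx0 : v x0 = 1 := by simp [v, e0, e1, basisState_apply, hx.symm]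
      rw [this, hvx0, hvx1, norm_one, Complex.norm_real, Real.norm_eq_abs, abs_of_pos hε0]
      nlinarith
  have hexact : ∃ (a : Fin 2 → ℂ) (g : Fin 2 → QReg 1 → ℂ), (∀ i, D (g i)) ∧ e1 = ∑ i, a i • g i := by
    refine ⟨![(ε : ℂ)⁻¹, -(ε : ℂ)⁻¹], ![v, e0], ?_, ?_⟩
    · intro i
      fin_cases i
      · exact Or.inr rfl
      · exact Or.inl rfl
    · have hεc : (ε : ℂ) ≠ 0 := Complex.ofReal_ne_zero.2 hε0.ne'
      rw [Fin.sum_univ_two]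
      simp only [Matrix.cons_val_zero, Matrix.cons_val_one]
      rw [show v = e0 + (ε : ℂ) • e1 from rfl, smul_add, smul_smul, inv_mul_cancel₀ hεc, one_smul,
        neg_smul]
      abel
  -- apply the schema and derive a contradiction at the amplitude `x1`
  obtain ⟨r, a, g, hr, hg, ha, herr⟩ := h D e1 hψ hD hexact
  have hgx1 : ∀ i, ‖g i x1‖ ≤ ε := by
    intro i
    rcases hg i with hgi | hgi
    · rw [hgi, he0x1, norm_zero]; exact hε0.le
    · rw [hgi, hvx1, Complex.norm_real, Real.norm_eq_abs, abs_of_pos hε0]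
  have hsum : ‖(∑ i, a i • g i) x1‖ ≤ 1 / 2 := by
    calc ‖(∑ i, a i • g i) x1‖ = ‖∑ i, a i * g i x1‖ := by simp [Finset.sum_apply]
      _ ≤ ∑ i, ‖a i * g i x1‖ := norm_sum_le _ _
      _ ≤ ∑ _i : Fin r, B' * ε := Finset.sum_le_sum fun i _ => by
          rw [norm_mul]
          exact mul_le_mul ((ha i).trans hBB') (hgx1 i) (norm_nonneg _) (by positivity)
      _ = r * (B' * ε) := by rw [Finset.sum_const, Finset.card_univ, Fintype.card_fin, nsmul_eq_mul]
      _ ≤ N * (B' * ε) := by gcongr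
      _ = N / (2 * (N + 1)) := by
          have hB'0 : (0 : ℝ) < B' := lt_of_lt_of_le one_pos (le_max_right B 1)
          simp only [ε]
          field_simp
      _ ≤ 1 / 2 := by
          rw [div_le_div_iff₀ (by positivity) (by positivity)]
          nlinarith [(Nat.cast_nonneg N : (0 : ℝ) ≤ N)]
  have hpt : (1 / 2 : ℝ) ^ 2 ≤ normSq (e1 - ∑ i, a i • g i) := by
    refine le_trans ?_ (norm_sq_apply_le_normSq _ x1)
    have h1 : (e1 - ∑ i, a i • g i) x1 = 1 - (∑ i, a i • g i) x1 := by
      rw [Pi.sub_apply, he1x1]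
    rw [h1]
    have h2 : 1 / 2 ≤ ‖(1 : ℂ) - (∑ i, a i • g i) x1‖ := by
      have := norm_sub_norm_le (1 : ℂ) ((∑ i, a i • g i) x1)
      rw [norm_one] at this
      linarith
    exact pow_le_pow_left₀ (by norm_num) h2 2
  linarith

/-! ## §6 No finite-`t` refutation of `X`: the quantifier structure is tight -/

/-- For every `t`, `|M⟩^{⊗t}` is an EXACT combination of the `2^(t·4)` computational basis states,
all Gaussian (`basisState_isGaussian`). [cite: CudbyStrelchuk2023, §6 (trivial bound)] -/
theorem thesis_at_each_t (t : ℕ) :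
    ∃ (a : Fin (2 ^ (t * 4)) → ℂ) (g : Fin (2 ^ (t * 4)) → QReg (t * 4) → ℂ),
      (∀ i, IsGaussian (g i)) ∧ magicMPow t = ∑ i, a i • g i := by
  have hcard : Fintype.card (QReg (t * 4)) = 2 ^ (t * 4) := by simp
  let e : QReg (t * 4) ≃ Fin (2 ^ (t * 4)) := Fintype.equivFinOfCardEq hcard
  refine ⟨fun i => magicMPow t (e.symm i), fun i => basisState (e.symm i),
    fun i => basisState_isGaussian _, ?_⟩
  calc magicMPow t = ∑ x, magicMPow t x • basisState x :=
        state_eq_sum_amplitude_smul_basisState _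
    _ = ∑ i, magicMPow t (e.symm i) • basisState (e.symm i) :=
        (Equiv.sum_comp e.symm (fun x => magicMPow t x • basisState x)).symm

/-- **`X` truncated to any finite horizon `T` holds** (with `c = 2^(T·4)` and error `0`): a
refutation of `X` — hence any ex-falso proof of the crux — is necessarily asymptotic in `t`, and a
disproof of the crux must supply polynomial-rank decompositions for ALL `t`. [folklore] -/
theorem thesis_truncated (T : ℕ) : ∀ δ : ℝ, 0 < δ → ∃ c : ℕ, ∀ t ≤ T, ∃ r : ℕ, r ≤ t ^ c + c ∧
    ∃ (a : Fin r → ℂ) (g : Fin r → QReg (t * 4) → ℂ),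
      (∀ i, IsGaussian (g i)) ∧ normSq (magicMPow t - ∑ i, a i • g i) ≤ δ ^ 2 := by
  intro δ _
  refine ⟨2 ^ (T * 4), fun t ht => ⟨2 ^ (t * 4), ?_, ?_⟩⟩
  · calc 2 ^ (t * 4) ≤ 2 ^ (T * 4) :=
          Nat.pow_le_pow_right (by norm_num) (Nat.mul_le_mul_right 4 ht)
      _ ≤ t ^ (2 ^ (T * 4)) + 2 ^ (T * 4) := Nat.le_add_left _ _
  · obtain ⟨a, g, hg, heq⟩ := thesis_at_each_t t
    refine ⟨a, g, hg, ?_⟩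
    rw [← heq, sub_self]
    have h0 : normSq (0 : QReg (t * 4) → ℂ) = 0 := by simp [normSq]
    rw [h0]
    positivity


/-! ## §7 (gen 2) Exponential coefficients are forced: the poly-coefficient strengthening of `X` is false modulo the printed fidelity bound -/

/-! ### Hermitian form `star ψ ⬝ᵥ χ` on `QReg n → ℂ`: transport to `EuclideanSpace` -/

/-- `‖toLp 2 x‖² = normSq x`. [folklore] -/
theorem norm_sq_toLp_eq_normSq {n : ℕ} (x : QReg n → ℂ) :
    ‖(WithLp.toLp 2 x : EuclideanSpace ℂ (QReg n))‖ ^ 2 = normSq x := by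
  rw [EuclideanSpace.norm_sq_eq]
  rfl

/-- **Cauchy–Schwarz** for the Hermitian form: `|⟨ψ, χ⟩|² ≤ ‖ψ‖² ‖χ‖²`. [folklore] -/
theorem norm_star_dotProduct_sq_le {n : ℕ} (ψ χ : QReg n → ℂ) :
    ‖star ψ ⬝ᵥ χ‖ ^ 2 ≤ normSq ψ * normSq χ := by
  have h := norm_inner_le_norm (𝕜 := ℂ) (WithLp.toLp 2 ψ : EuclideanSpace ℂ (QReg n))
    (WithLp.toLp 2 χ : EuclideanSpace ℂ (QReg n))
  rw [EuclideanSpace.inner_toLp_toLp, dotProduct_comm] at h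
  have h2 := pow_le_pow_left₀ (norm_nonneg _) h 2
  rwa [mul_pow, norm_sq_toLp_eq_normSq, norm_sq_toLp_eq_normSq] at h2

/-- `⟨ψ, ψ⟩ = ‖ψ‖²`. [folklore] -/
theorem star_dotProduct_self_eq_normSq {n : ℕ} (ψ : QReg n → ℂ) :
    star ψ ⬝ᵥ ψ = ((normSq ψ : ℝ) : ℂ) := by
  unfold dotProduct normSq
  push_cast
  refine Finset.sum_congr rfl fun x _ => ?_
  rw [Pi.star_apply, Complex.star_def, Complex.conj_mul']

/-! ### The ℓ¹ lower bound from a fidelity bound -/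

/-- **ℓ¹ LOWER BOUND.** If `‖ψ‖ = 1`, `‖ψ − Σ aᵢ gᵢ‖ ≤ δ` and every overlap satisfies
`|⟨ψ, gᵢ⟩|² ≤ F`, then `1 − δ ≤ √F · Σ ‖aᵢ‖`: a `δ`-approximation of `ψ` by dictionary elements
of fidelity `≤ F` has coefficient `ℓ¹`-mass at least `(1 − δ)/√F` (the standard extent-type bound;
no normalisation of the `gᵢ` is needed in this form). [cite: CudbyStrelchuk2023, §5.2 (ξ ≥ 1/F)] -/
theorem one_sub_le_sqrt_mul_sum_norm {n r : ℕ} (ψ : QReg n → ℂ) (a : Fin r → ℂ)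
    (g : Fin r → QReg n → ℂ) {δ F : ℝ} (hδ : 0 ≤ δ) (hψ : normSq ψ = 1)
    (herr : normSq (ψ - ∑ i, a i • g i) ≤ δ ^ 2)
    (hov : ∀ i, ‖star ψ ⬝ᵥ g i‖ ^ 2 ≤ F) :
    1 - δ ≤ Real.sqrt F * ∑ i, ‖a i‖ := by
  set φ : QReg n → ℂ := ∑ i, a i • g i with hφ
  have h1 : star ψ ⬝ᵥ φ = 1 - star ψ ⬝ᵥ (ψ - φ) := by
    rw [dotProduct_sub, star_dotProduct_self_eq_normSq, hψ]
    push_cast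
    ring
  have h2 : ‖star ψ ⬝ᵥ (ψ - φ)‖ ≤ δ := by
    have hcs := norm_star_dotProduct_sq_le ψ (ψ - φ)
    rw [hψ, one_mul] at hcs
    calc ‖star ψ ⬝ᵥ (ψ - φ)‖ = Real.sqrt (‖star ψ ⬝ᵥ (ψ - φ)‖ ^ 2) :=
          (Real.sqrt_sq (norm_nonneg _)).symm
      _ ≤ Real.sqrt (δ ^ 2) := Real.sqrt_le_sqrt (hcs.trans herr)
      _ = δ := Real.sqrt_sq hδ
  have h3 : 1 - δ ≤ ‖star ψ ⬝ᵥ φ‖ := by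
    rw [h1]
    have := norm_sub_norm_le (1 : ℂ) (star ψ ⬝ᵥ (ψ - φ))
    rw [norm_one] at this
    linarith
  have h4 : ‖star ψ ⬝ᵥ φ‖ ≤ Real.sqrt F * ∑ i, ‖a i‖ := by
    have hexp : star ψ ⬝ᵥ φ = ∑ i, a i * (star ψ ⬝ᵥ g i) := by
      simp only [hφ, dotProduct_sum, dotProduct_smul, smul_eq_mul]
    rw [hexp, Finset.mul_sum]
    refine (norm_sum_le _ _).trans (Finset.sum_le_sum fun i _ => ?_)
    rw [norm_mul, mul_comm]
    have hgi : ‖star ψ ⬝ᵥ g i‖ ≤ Real.sqrt F := by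
      have := Real.abs_le_sqrt (hov i)
      rwa [abs_of_nonneg (norm_nonneg _)] at this
    exact mul_le_mul_of_nonneg_right hgi (norm_nonneg _)
  exact h3.trans h4

/-! ### `|M⟩^{⊗t}` is a unit vector -/

/-- The block-constant strings of `QReg (t*4)` are in bijection with `Fin t → Bool`. [folklore] -/
def blockConstEquiv (t : ℕ) :
    {x : QReg (t * 4) // ∀ k : Fin t, ∀ i : Fin 4,
      x (finProdFinEquiv (k, i)) = x (finProdFinEquiv (k, (0 : Fin 4)))} ≃ (Fin t → Bool) where
  toFun x := fun k => x.1 (finProdFinEquiv (k, (0 : Fin 4)))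
  invFun y := ⟨fun m => y (finProdFinEquiv.symm m).1, fun k i => by simp⟩
  left_inv x := by
    obtain ⟨x, hx⟩ := x
    apply Subtype.ext
    funext m
    obtain ⟨⟨k, i⟩, rfl⟩ := finProdFinEquiv.surjective m
    simp only [Equiv.symm_apply_apply]
    exact (hx k i).symm
  right_inv y := by
    funext k
    simp

/-- There are `2^t` block-constant strings on `t*4` wires. [folklore] -/
theorem card_blockConst (t : ℕ) :
    (Finset.univ.filter (fun x : QReg (t * 4) => ∀ k : Fin t, ∀ i : Fin 4,
      x (finProdFinEquiv (k, i)) = x (finProdFinEquiv (k, (0 : Fin 4))))).card = 2 ^ t := by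
  classical
  rw [← Fintype.card_subtype, Fintype.card_congr (blockConstEquiv t)]
  simp

/-- **`|M⟩^{⊗t}` is a unit vector**: `normSq (magicMPow t) = 1` (`2^t` amplitudes of squared modulus
`2^{-t}`). [cite: CudbyStrelchuk2023, §6] -/
theorem normSq_magicMPow (t : ℕ) : normSq (magicMPow t) = 1 := by
  classical
  have hs : ‖((Real.sqrt 2 : ℂ)⁻¹) ^ t‖ ^ 2 = ((1 : ℝ) / 2) ^ t := by
    rw [norm_pow, norm_inv, Complex.norm_real, Real.norm_eq_abs,
      abs_of_nonneg (Real.sqrt_nonneg 2), ← pow_mul, mul_comm, pow_mul, inv_pow,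
      Real.sq_sqrt (by norm_num : (0 : ℝ) ≤ 2), one_div]
  unfold normSq
  have : ∀ x : QReg (t * 4), ‖magicMPow t x‖ ^ 2 =
      if (∀ k : Fin t, ∀ i : Fin 4, x (finProdFinEquiv (k, i)) = x (finProdFinEquiv (k, (0 : Fin 4))))
      then ((1 : ℝ) / 2) ^ t else 0 := by
    intro x
    rw [magicMPow_apply]
    split_ifs
    · exact hs
    · simp
  simp_rw [this]
  rw [Finset.sum_ite, Finset.sum_const_zero, add_zero, Finset.sum_const, card_blockConst,
    nsmul_eq_mul]
  push_cast
  rw [← mul_pow]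
  norm_num

/-! ### The printed fidelity bound and the poly-coefficient strengthening of `X` -/

/-- **Gaussian fidelity of the matchgate-magic powers** (as a `Prop`, no claim made by the
definition): for every Gaussian `g` on `4t` qubits, `|⟨M^{⊗t}, g⟩|² ≤ 2^{-t} ‖g‖²`, i.e.
`F_𝒢(M^{⊗t}) ≤ 2^{-t}` (with equality, witnessed by `|0^{4t}⟩`). PRINTED: CudbyStrelchuk2023
Lemma 3 with Appendix 9 ("feasibility of k copies of the extreme state": `η₄^{⊗k} ∈ M_{𝒢_{4k}}`,
`η₄ = |0⟩ + |15⟩ = √2 |M⟩`, an explicit SDP-dual certificate built from the quadratic Gaussian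
constraints); the `t = 2` case is also DiasKoenig2024 Thm 5.10 (multiplicativity of the Gaussian
fidelity for two positive-parity 4-mode factors). Not yet a tree fact: its proof needs the quadratic
(Cartan/Plücker) relations between the amplitudes of a Gaussian state, absent from the tree.
[cite: CudbyStrelchuk2023, Lemma 3 and App. 9] -/
def MagicPowFidelityBound : Prop :=
  ∀ (t : ℕ) (g : QReg (t * 4) → ℂ), IsGaussian g →
    ‖star (magicMPow t) ⬝ᵥ g‖ ^ 2 ≤ ((1 : ℝ) / 2) ^ t * normSq g

/-- **Poly-coefficient `X`** — the natural strengthening of the route's target in which not only the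
NUMBER of Gaussian terms but also the COEFFICIENTS are polynomially bounded (unit terms,
`‖aᵢ‖ ≤ t^c + c`). [folklore] -/
def GaussRankPolyPolyCoeffThesis : Prop :=
  ∀ δ : ℝ, 0 < δ → ∃ c : ℕ, ∀ t : ℕ, ∃ r : ℕ, r ≤ t ^ c + c ∧
    ∃ (a : Fin r → ℂ) (g : Fin r → QReg (t * 4) → ℂ),
      (∀ i, IsGaussian (g i) ∧ normSq (g i) = 1 ∧ ‖a i‖ ≤ (t : ℝ) ^ c + c) ∧
        normSq (magicMPow t - ∑ i, a i • g i) ≤ δ ^ 2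

/-- Poly-coefficient `X` implies `X` (forget the bounds): it IS a strengthening of the target.
[folklore] -/
theorem thesis_of_polyCoeff (h : GaussRankPolyPolyCoeffThesis) : GaussRankPolyThesis := by
  intro δ hδ
  obtain ⟨c, hc⟩ := h δ hδ
  refine ⟨c, fun t => ?_⟩
  obtain ⟨r, hr, a, g, hg, hle⟩ := hc t
  exact ⟨r, hr, a, g, fun i => (hg i).1, hle⟩

/-- Exponentials beat polynomials: some `t ≥ 1` has `4 (t^c + c)^4 < 2^t`. [folklore] -/
theorem exists_two_pow_gt (c : ℕ) : ∃ t : ℕ, 1 ≤ t ∧ 4 * ((t : ℝ) ^ c + c) ^ 4 < (2 : ℝ) ^ t := by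
  have hlo := isLittleO_pow_const_const_pow_of_one_lt (R := ℝ) (4 * c) (one_lt_two)
  have hε : (0 : ℝ) < 1 / (8 * ((c : ℝ) + 1) ^ 4) := by positivity
  obtain ⟨N, hN⟩ := Filter.eventually_atTop.1 (hlo.def hε)
  refine ⟨max N 1, le_max_right _ _, ?_⟩
  have h1t : (1 : ℝ) ≤ (max N 1 : ℕ) := by exact_mod_cast le_max_right N 1
  have hb := hN (max N 1) (le_max_left _ _)
  rw [Real.norm_of_nonneg (by positivity), Real.norm_of_nonneg (by positivity)] at hb
  set T : ℝ := ((max N 1 : ℕ) : ℝ) with hT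
  have hpoly : (T ^ c + c) ^ 4 ≤ ((c : ℝ) + 1) ^ 4 * T ^ (4 * c) := by
    have hTc : (1 : ℝ) ≤ T ^ c := one_le_pow₀ h1t
    have hle : T ^ c + c ≤ ((c : ℝ) + 1) * T ^ c := by
      nlinarith [(Nat.cast_nonneg c : (0 : ℝ) ≤ c)]
    calc (T ^ c + c) ^ 4 ≤ (((c : ℝ) + 1) * T ^ c) ^ 4 := pow_le_pow_left₀ (by positivity) hle 4
      _ = ((c : ℝ) + 1) ^ 4 * T ^ (4 * c) := by rw [mul_pow, ← pow_mul, mul_comm c 4]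
  have h2pos : (0 : ℝ) < 2 ^ (max N 1) := by positivity
  calc 4 * (T ^ c + c) ^ 4 ≤ 4 * (((c : ℝ) + 1) ^ 4 * T ^ (4 * c)) := by gcongr
    _ ≤ 4 * (((c : ℝ) + 1) ^ 4 * (1 / (8 * ((c : ℝ) + 1) ^ 4) * 2 ^ (max N 1))) := by gcongr
    _ = 2 ^ (max N 1) / 2 := by field_simp; ring
    _ < 2 ^ (max N 1) := by linarith

/-- **The poly-coefficient strengthening of `X` is FALSE, given the printed fidelity bound**
(`F_𝒢(M^{⊗t}) ≤ 2^{-t}`, CudbyStrelchuk2023 Lemma 3): at `δ = 1/2` every decomposition has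
`Σ ‖aᵢ‖ ≥ 2^{t/2}/2`, incompatible with `r, ‖aᵢ‖ ≤ t^c + c` for large `t`. MEANING FOR THE
PACKAGING: any proof of the crux through a simulator must carry coefficients of modulus
`≥ 2^{t/2}/(2r)` — cancellation at scale `2^{-Θ(t)}` is forced, so `Θ(t)`-bit precision per
amplitude is the floor (still polynomial: consistent with `GaussRankPolyBoundedThesis`, whose
`2^(t^c+c)` allowance cannot be lowered to `poly(t)`). [cite: CudbyStrelchuk2023, Lemma 3] -/
theorem polyCoeffThesis_false_of_fidelityBound (hF : MagicPowFidelityBound) :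
    ¬ GaussRankPolyPolyCoeffThesis := by
  intro hX
  obtain ⟨c, hc⟩ := hX (1 / 2) one_half_pos
  obtain ⟨t, -, ht⟩ := exists_two_pow_gt c
  obtain ⟨r, hr, a, g, hg, herr⟩ := hc t
  have hov : ∀ i, ‖star (magicMPow t) ⬝ᵥ g i‖ ^ 2 ≤ ((1 : ℝ) / 2) ^ t := fun i => by
    have := hF t (g i) (hg i).1
    rwa [(hg i).2.1, mul_one] at this
  have hl1 := one_sub_le_sqrt_mul_sum_norm (magicMPow t) a g (by norm_num : (0 : ℝ) ≤ 1 / 2)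
    (normSq_magicMPow t) herr hov
  have hsum : ∑ i, ‖a i‖ ≤ ((t : ℝ) ^ c + c) ^ 2 := by
    calc ∑ i, ‖a i‖ ≤ ∑ _i : Fin r, ((t : ℝ) ^ c + c) := Finset.sum_le_sum fun i _ => (hg i).2.2
      _ = r * ((t : ℝ) ^ c + c) := by
          rw [Finset.sum_const, Finset.card_univ, Fintype.card_fin, nsmul_eq_mul]
      _ ≤ ((t : ℝ) ^ c + c) * ((t : ℝ) ^ c + c) := by
          gcongr
          exact_mod_cast hr
      _ = ((t : ℝ) ^ c + c) ^ 2 := (sq _).symm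
  have h1 : (1 : ℝ) / 2 ≤ Real.sqrt (((1 : ℝ) / 2) ^ t) * ((t : ℝ) ^ c + c) ^ 2 := by
    have := mul_le_mul_of_nonneg_left hsum (Real.sqrt_nonneg (((1 : ℝ) / 2) ^ t))
    linarith
  have h2 : ((1 : ℝ) / 2) ^ 2 ≤ ((1 : ℝ) / 2) ^ t * ((t : ℝ) ^ c + c) ^ 4 := by
    have := pow_le_pow_left₀ (by norm_num) h1 2
    rw [mul_pow, Real.sq_sqrt (by positivity), ← pow_mul] at this
    simpa using this
  have hhalf : (2 : ℝ) ^ t * ((1 : ℝ) / 2) ^ t = 1 := by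
    rw [← mul_pow]; norm_num
  have h3 : (2 : ℝ) ^ t ≤ 4 * ((t : ℝ) ^ c + c) ^ 4 := by
    have h4 := mul_le_mul_of_nonneg_left h2 (by positivity : (0 : ℝ) ≤ 4 * 2 ^ t)
    calc (2 : ℝ) ^ t = 4 * 2 ^ t * ((1 : ℝ) / 2) ^ 2 := by ring
      _ ≤ 4 * 2 ^ t * (((1 : ℝ) / 2) ^ t * ((t : ℝ) ^ c + c) ^ 4) := h4
      _ = 4 * ((t : ℝ) ^ c + c) ^ 4 * ((2 : ℝ) ^ t * ((1 : ℝ) / 2) ^ t) := by ring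
      _ = 4 * ((t : ℝ) ^ c + c) ^ 4 := by rw [hhalf, mul_one]
  linarith

/-- … hence, given the fidelity bound, **every proof of `X` (if any) uses super-polynomial
coefficients**: `X ∧ ¬ poly-coefficient-X` is the only way `X` can hold. Recorded as the
implication `MagicPowFidelityBound → GaussRankPolyThesis → ¬ GaussRankPolyPolyCoeffThesis`
(trivial from the previous theorem; stated for the planner's restatement menu). [folklore] -/
theorem thesis_needs_big_coefficients (hF : MagicPowFidelityBound) :
    GaussRankPolyThesis → ¬ GaussRankPolyPolyCoeffThesis :=
  fun _ => polyCoeffThesis_false_of_fidelityBound hF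



/-! ## §8 (gen 2) The annihilator overlap bound: vanishing covariance ⇒ Gaussian fidelity ≤ 1/2 (operator form of the one-term mass bound) -/

/-- Adjointness: `⟨v, Aᴴ w⟩ = ⟨A v, w⟩`. [folklore] -/
theorem star_dotProduct_conjTranspose_mulVec {n : ℕ} (A : Matrix (QReg n) (QReg n) ℂ)
    (v w : QReg n → ℂ) : star v ⬝ᵥ (Aᴴ *ᵥ w) = star (A *ᵥ v) ⬝ᵥ w := by
  rw [dotProduct_mulVec, star_mulVec]

/-- Adjointness: `⟨v, A w⟩ = ⟨Aᴴ v, w⟩`. [folklore] -/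
theorem star_dotProduct_mulVec {n : ℕ} (A : Matrix (QReg n) (QReg n) ℂ)
    (v w : QReg n → ℂ) : star v ⬝ᵥ (A *ᵥ w) = star (Aᴴ *ᵥ v) ⬝ᵥ w := by
  rw [dotProduct_mulVec, star_mulVec, conjTranspose_conjTranspose]

/-- **ANNIHILATOR OVERLAP BOUND** (operator form of the one-term mass bound). If `L g = 0` and
`L Lᴴ + Lᴴ L = 2ν · 1` with `ν > 0` (so `b = L/√(2ν)` is a canonical fermionic mode with `g` in its
kernel), then for every `ψ`:  `2ν |⟨g, ψ⟩|² ≤ ‖g‖² (2ν ‖ψ‖² − ‖L ψ‖²)`, i.e.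
`|⟨g, ψ⟩|² ≤ ‖g‖² (‖ψ‖² − ‖b ψ‖²)`.  Proof: `2ν⟨g,ψ⟩ = ⟨g,(LLᴴ + LᴴL)ψ⟩ = ⟨Lᴴg, Lᴴψ⟩ + ⟨Lg, Lψ⟩ =
⟨Lᴴg, Lᴴψ⟩`, Cauchy–Schwarz, `‖Lᴴg‖² = 2ν‖g‖² − ‖Lg‖² = 2ν‖g‖²`, `‖Lᴴψ‖² = 2ν‖ψ‖² − ‖Lψ‖²`. [folklore] -/
theorem overlap_bound_of_annihilator {n : ℕ} (L : Matrix (QReg n) (QReg n) ℂ) (g ψ : QReg n → ℂ)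
    (ν : ℝ) (hν : 0 < ν)
    (hCAR : L * Lᴴ + Lᴴ * L = ((2 * ν : ℝ) : ℂ) • (1 : Matrix (QReg n) (QReg n) ℂ))
    (hLg : L *ᵥ g = 0) :
    2 * ν * ‖star g ⬝ᵥ ψ‖ ^ 2 ≤ normSq g * (2 * ν * normSq ψ - normSq (L *ᵥ ψ)) := by
  set c : ℂ := ((2 * ν : ℝ) : ℂ) with hc
  have hLLH : L * Lᴴ = c • (1 : Matrix (QReg n) (QReg n) ℂ) - Lᴴ * L := eq_sub_of_add_eq hCAR
  -- (i) the key identity `c ⟨g,ψ⟩ = ⟨Lᴴ g, Lᴴ ψ⟩`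
  have key : c * (star g ⬝ᵥ ψ) = star (Lᴴ *ᵥ g) ⬝ᵥ (Lᴴ *ᵥ ψ) := by
    have h1 : c • ψ = (L * Lᴴ + Lᴴ * L) *ᵥ ψ := by
      rw [hCAR, smul_mulVec, one_mulVec]
    calc c * (star g ⬝ᵥ ψ) = star g ⬝ᵥ (c • ψ) := by rw [dotProduct_smul, smul_eq_mul]
      _ = star g ⬝ᵥ (L *ᵥ (Lᴴ *ᵥ ψ)) + star g ⬝ᵥ (Lᴴ *ᵥ (L *ᵥ ψ)) := by
          rw [h1, add_mulVec, dotProduct_add, ← mulVec_mulVec, ← mulVec_mulVec]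
      _ = star (Lᴴ *ᵥ g) ⬝ᵥ (Lᴴ *ᵥ ψ) + star (L *ᵥ g) ⬝ᵥ (L *ᵥ ψ) := by
          rw [star_dotProduct_mulVec L g (Lᴴ *ᵥ ψ), star_dotProduct_conjTranspose_mulVec L g (L *ᵥ ψ)]
      _ = star (Lᴴ *ᵥ g) ⬝ᵥ (Lᴴ *ᵥ ψ) := by rw [hLg, star_zero, zero_dotProduct, add_zero]
  -- (ii) `‖Lᴴ g‖² = 2ν ‖g‖²`
  have hA : normSq (Lᴴ *ᵥ g) = 2 * ν * normSq g := by
    have h : star (Lᴴ *ᵥ g) ⬝ᵥ (Lᴴ *ᵥ g) = c * (star g ⬝ᵥ g) := by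
      rw [← star_dotProduct_mulVec L g (Lᴴ *ᵥ g), mulVec_mulVec, hLLH, sub_mulVec, smul_mulVec,
        one_mulVec, ← mulVec_mulVec, hLg, mulVec_zero, sub_zero, dotProduct_smul, smul_eq_mul]
    rw [star_dotProduct_self_eq_normSq, star_dotProduct_self_eq_normSq, hc] at h
    exact_mod_cast h
  -- (iii) `‖Lᴴ ψ‖² = 2ν ‖ψ‖² − ‖L ψ‖²`
  have hB : normSq (Lᴴ *ᵥ ψ) = 2 * ν * normSq ψ - normSq (L *ᵥ ψ) := by
    have h : star (Lᴴ *ᵥ ψ) ⬝ᵥ (Lᴴ *ᵥ ψ) = c * (star ψ ⬝ᵥ ψ) - star (L *ᵥ ψ) ⬝ᵥ (L *ᵥ ψ) := by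
      rw [← star_dotProduct_mulVec L ψ (Lᴴ *ᵥ ψ), mulVec_mulVec, hLLH, sub_mulVec, smul_mulVec,
        one_mulVec, ← mulVec_mulVec, dotProduct_sub, dotProduct_smul, smul_eq_mul,
        star_dotProduct_conjTranspose_mulVec L ψ (L *ᵥ ψ)]
    rw [star_dotProduct_self_eq_normSq, star_dotProduct_self_eq_normSq,
      star_dotProduct_self_eq_normSq, hc] at h
    exact_mod_cast h
  -- (iv) Cauchy–Schwarz and bookkeeping
  have hcs := norm_star_dotProduct_sq_le (Lᴴ *ᵥ g) (Lᴴ *ᵥ ψ)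
  rw [← key, norm_mul, mul_pow, hA, hB, hc, Complex.norm_real, Real.norm_eq_abs,
    abs_of_pos (by positivity : (0 : ℝ) < 2 * ν)] at hcs
  -- hcs : (2ν)² X ≤ 2ν ‖g‖² (2ν‖ψ‖² − ‖Lψ‖²)
  have h2ν : (0 : ℝ) < 2 * ν := by positivity
  nlinarith [hcs, h2ν, sq_nonneg ‖star g ⬝ᵥ ψ‖]

/-! ### Specialisation: a Gaussian state and a vector with vanishing covariance matrix -/

/-- The adjoint of a Majorana combination `c(u) = Σ_p u_p c_p` is `c(ū)`. [folklore] -/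
theorem conjTranspose_majoranaComb {n : ℕ} (u : Fin n × Bool → ℂ) :
    (∑ p : Fin n × Bool, u p • majorana n p.1 p.2)ᴴ =
      ∑ p : Fin n × Bool, star (u p) • majorana n p.1 p.2 := by
  rw [conjTranspose_sum]
  refine Finset.sum_congr rfl fun p _ => ?_
  rw [conjTranspose_smul, conjTranspose_majorana]

/-- **CAR for a Majorana combination**: `c(u) c(u)ᴴ + c(u)ᴴ c(u) = 2 (Σ_p |u_p|²) · 1`. [folklore] -/
theorem majoranaComb_car {n : ℕ} (u : Fin n × Bool → ℂ) :
    (∑ p : Fin n × Bool, u p • majorana n p.1 p.2) * (∑ p : Fin n × Bool, u p • majorana n p.1 p.2)ᴴ +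
      (∑ p : Fin n × Bool, u p • majorana n p.1 p.2)ᴴ * (∑ p : Fin n × Bool, u p • majorana n p.1 p.2) =
      ((2 * ∑ p : Fin n × Bool, ‖u p‖ ^ 2 : ℝ) : ℂ) • (1 : Matrix (QReg n) (QReg n) ℂ) := by
  rw [conjTranspose_majoranaComb, Finset.sum_mul_sum, Finset.sum_mul_sum, Finset.sum_comm (s := Finset.univ)
    (t := Finset.univ) (f := fun p q => star (u p) • majorana n p.1 p.2 * (u q • majorana n q.1 q.2)),
    ← Finset.sum_add_distrib]
  have hterm : ∀ p : Fin n × Bool, (∑ q : Fin n × Bool, u p • majorana n p.1 p.2 * (star (u q) • majorana n q.1 q.2)) +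
      (∑ q : Fin n × Bool, star (u q) • majorana n q.1 q.2 * (u p • majorana n p.1 p.2)) =
      ((‖u p‖ : ℂ) ^ 2) • ((2 : ℂ) • (1 : Matrix (QReg n) (QReg n) ℂ)) := by
    intro p
    rw [← Finset.sum_add_distrib]
    have : ∀ q : Fin n × Bool, u p • majorana n p.1 p.2 * (star (u q) • majorana n q.1 q.2) +
        star (u q) • majorana n q.1 q.2 * (u p • majorana n p.1 p.2) =
        (u p * star (u q)) • (if p = q then (2 : ℂ) • (1 : Matrix (QReg n) (QReg n) ℂ) else 0) := by
      intro q
      rw [smul_mul_smul_comm, smul_mul_smul_comm, mul_comm (star (u q)) (u p), ← smul_add,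
        majorana_anticommutator]
    simp_rw [this]
    rw [Finset.sum_eq_single p]
    · rw [if_pos rfl, Complex.star_def, Complex.mul_conj']
    · intro q _ hq
      rw [if_neg (Ne.symm hq), smul_zero]
    · intro h; exact absurd (Finset.mem_univ p) h
  simp_rw [hterm]
  rw [← Finset.sum_smul, smul_smul]
  congr 1
  push_cast
  rw [Finset.sum_mul, Finset.mul_sum]
  refine Finset.sum_congr rfl fun p _ => ?_
  ring

/-- `‖c(u) ψ‖² = Σ_{p,q} ū_p u_q ⟨ψ, c_p c_q ψ⟩`; with VANISHING COVARIANCE (`⟨ψ, c_p c_q ψ⟩ = δ_pq ‖ψ‖²`)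
this is `(Σ_p |u_p|²) ‖ψ‖²`. [folklore] -/
theorem normSq_majoranaComb_mulVec_of_cov {n : ℕ} (u : Fin n × Bool → ℂ) (ψ : QReg n → ℂ)
    (hcov : ∀ p q : Fin n × Bool, star ψ ⬝ᵥ (majorana n p.1 p.2 *ᵥ (majorana n q.1 q.2 *ᵥ ψ)) =
      if p = q then ((normSq ψ : ℝ) : ℂ) else 0) :
    normSq ((∑ p : Fin n × Bool, u p • majorana n p.1 p.2) *ᵥ ψ) =
      (∑ p : Fin n × Bool, ‖u p‖ ^ 2) * normSq ψ := by
  set L := ∑ p : Fin n × Bool, u p • majorana n p.1 p.2 with hL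
  have hLψ : L *ᵥ ψ = ∑ q : Fin n × Bool, u q • (majorana n q.1 q.2 *ᵥ ψ) := by
    rw [hL, sum_mulVec]
    refine Finset.sum_congr rfl fun q _ => ?_
    rw [smul_mulVec]
  have hLH : Lᴴ = ∑ p : Fin n × Bool, star (u p) • majorana n p.1 p.2 := by
    rw [hL, conjTranspose_majoranaComb]
  have h : star (L *ᵥ ψ) ⬝ᵥ (L *ᵥ ψ) = (((∑ p : Fin n × Bool, ‖u p‖ ^ 2) * normSq ψ : ℝ) : ℂ) := by
    rw [← star_dotProduct_conjTranspose_mulVec L ψ (L *ᵥ ψ), hLH, sum_mulVec, dotProduct_sum]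
    have inner : ∀ p : Fin n × Bool,
        star ψ ⬝ᵥ ((star (u p) • majorana n p.1 p.2) *ᵥ (L *ᵥ ψ)) = star (u p) * u p * ((normSq ψ : ℝ) : ℂ) := by
      intro p
      rw [smul_mulVec, dotProduct_smul, smul_eq_mul, hLψ, mulVec_sum, dotProduct_sum]
      have : ∀ q : Fin n × Bool, star ψ ⬝ᵥ (majorana n p.1 p.2 *ᵥ (u q • (majorana n q.1 q.2 *ᵥ ψ))) =
          u q * (if p = q then ((normSq ψ : ℝ) : ℂ) else 0) := by
        intro q
        rw [mulVec_smul, dotProduct_smul, smul_eq_mul, hcov]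
      simp_rw [this]
      rw [Finset.sum_eq_single p]
      · rw [if_pos rfl, mul_assoc]
      · intro q _ hq
        rw [if_neg (Ne.symm hq), mul_zero]
      · intro h; exact absurd (Finset.mem_univ p) h
    simp_rw [inner]
    rw [← Finset.sum_mul]
    push_cast
    congr 1
    refine Finset.sum_congr rfl fun p _ => ?_
    rw [Complex.star_def, Complex.conj_mul']
  rw [star_dotProduct_self_eq_normSq] at h
  exact_mod_cast h

/-- **VANISHING COVARIANCE ⇒ GAUSSIAN FIDELITY ≤ 1/2.** If `ψ` on `n ≥ 1` qubits has vanishing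
covariance matrix in the strong form `⟨ψ, c_p c_q ψ⟩ = δ_pq ‖ψ‖²`, then every Gaussian `g` has
`|⟨g, ψ⟩|² ≤ ‖g‖² ‖ψ‖² / 2`. (Take `L = c(u)` for the first annihilator row `u` of `g`: `ν = Σ|u_p|² > 0`,
`‖Lψ‖² = ν‖ψ‖²` by the covariance hypothesis, and apply the annihilator overlap bound.) Applies to
`|M⟩^{⊗t}` (`t ≥ 1`, tight at `t = 1`) once the flat orthonormality of crux 1245 (`stub_flatOrthoOfInvariant`
+ the landed `stub_magicInvariant`) is a theorem; it is the `r = 1, K = 1` case of that line, in operator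
form. [folklore] -/
theorem gaussian_overlap_sq_le_half_of_cov {n : ℕ} (hn : 0 < n) (ψ : QReg n → ℂ)
    (hcov : ∀ p q : Fin n × Bool, star ψ ⬝ᵥ (majorana n p.1 p.2 *ᵥ (majorana n q.1 q.2 *ᵥ ψ)) =
      if p = q then ((normSq ψ : ℝ) : ℂ) else 0)
    (g : QReg n → ℂ) (hg : IsGaussian g) :
    ‖star g ⬝ᵥ ψ‖ ^ 2 ≤ normSq g * normSq ψ / 2 := by
  obtain ⟨-, A, hA, hann⟩ := hg
  set u : Fin n × Bool → ℂ := A ⟨0, hn⟩ with hu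
  have hu0 : u ≠ 0 := hA.ne_zero ⟨0, hn⟩
  set ν : ℝ := ∑ p : Fin n × Bool, ‖u p‖ ^ 2 with hν
  have hνpos : 0 < ν := by
    obtain ⟨p, hp⟩ : ∃ p, u p ≠ 0 := by
      by_contra hno
      push Not at hno
      exact hu0 (funext hno)
    exact lt_of_lt_of_le (by positivity : (0 : ℝ) < ‖u p‖ ^ 2)
      (Finset.single_le_sum (f := fun q => ‖u q‖ ^ 2) (fun _ _ => by positivity) (Finset.mem_univ p))
  set L := ∑ p : Fin n × Bool, u p • majorana n p.1 p.2 with hL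
  have hCAR : L * Lᴴ + Lᴴ * L = ((2 * ν : ℝ) : ℂ) • (1 : Matrix (QReg n) (QReg n) ℂ) := by
    rw [hL, majoranaComb_car]
  have hLg : L *ᵥ g = 0 := hann ⟨0, hn⟩
  have hb := overlap_bound_of_annihilator L g ψ ν hνpos hCAR hLg
  rw [hL, normSq_majoranaComb_mulVec_of_cov u ψ hcov] at hb
  have hg0 : 0 ≤ normSq g := Finset.sum_nonneg fun _ _ => by positivity
  have hψ0 : 0 ≤ normSq ψ := Finset.sum_nonneg fun _ _ => by positivity
  nlinarith [hb, hνpos, hg0, hψ0, mul_nonneg hg0 hψ0]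



/-! ## §9–§10 (gen 2) THE GAUSSIAN FIDELITY BOUND `F_𝒢(M^{⊗t}) ≤ 2^{-t}` PROVED IN-TREE: quadratic relations from annihilators, the corner lemma, induction -/

/-! ### Majorana action on amplitudes (from G5) -/

/-- The Jordan–Wigner phase of `c_{j,β}` at the basis label `y`. [folklore] -/
def majPhase {n : ℕ} (j : Fin n) (β : Bool) (y : QReg n) : ℂ :=
  (if β then (if y j then Complex.I else -Complex.I) else 1) *
    ∏ i : Fin n, (if i < j ∧ y i = true then (-1 : ℂ) else 1)

/-- `‖majPhase‖ = 1`. [folklore] -/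
theorem norm_majPhase {n : ℕ} (j : Fin n) (β : Bool) (y : QReg n) : ‖majPhase j β y‖ = 1 := by
  unfold majPhase
  rw [norm_mul, norm_prod]
  have h1 : ‖(if β then (if y j then Complex.I else -Complex.I) else (1 : ℂ))‖ = 1 := by
    split_ifs <;> simp
  have h2 : ∀ i : Fin n, ‖(if i < j ∧ y i = true then (-1 : ℂ) else 1)‖ = 1 := by
    intro i; split_ifs <;> simp
  rw [h1, one_mul]
  exact Finset.prod_eq_one fun i _ => h2 i

/-- `majPhase j false y ^ 2 + majPhase j true y ^ 2 = 0` (the `X` and `Y` phases differ by `± i`).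
[folklore] -/
theorem majPhase_sq_add {n : ℕ} (j : Fin n) (y : QReg n) :
    majPhase j false y ^ 2 + majPhase j true y ^ 2 = 0 := by
  unfold majPhase
  set P := ∏ i : Fin n, (if i < j ∧ y i = true then (-1 : ℂ) else 1)
  cases y j <;> simp [mul_pow, Complex.I_sq]

/-- **Action of a Majorana on amplitudes**: `(c_{j,β} G)(y) = majPhase j β y · G(flip_j y)`. [folklore] -/
theorem majorana_mulVec_apply {n : ℕ} (j : Fin n) (β : Bool) (G : QReg n → ℂ) (y : QReg n) :
    (majorana n j β *ᵥ G) y = majPhase j β y * G (Function.update y j (!y j)) := by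
  classical
  rw [Matrix.mulVec, dotProduct, Finset.sum_eq_single (Function.update y j (!y j))]
  · rw [majorana_apply, majPhase]
    congr 1
    have hj : Function.update y j (!y j) j = !y j := Function.update_self _ _ _
    rw [hj]
    have hfac : (if β then Pauli.Y else Pauli.X).mat (y j) (!y j) =
        (if β then (if y j then Complex.I else -Complex.I) else 1) := by
      cases β <;> cases y j <;> simp
    rw [hfac]
    congr 1
    rw [← Finset.mul_prod_erase Finset.univ _ (Finset.mem_univ j)]
    have hjj : (if j < j ∧ y j = true then (-1 : ℂ) else 1) = 1 := by simp
    rw [hjj, one_mul]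
    refine Finset.prod_congr rfl fun i hi => ?_
    have hij : i ≠ j := Finset.ne_of_mem_erase hi
    rw [Function.update_of_ne hij]
    by_cases hlt : i < j
    · simp only [Pauli.mat_Z_apply, if_true, hlt, true_and]
    · simp only [Pauli.mat_I_apply, if_true, hlt, false_and, if_false]
  · intro x _ hx
    rw [majorana_apply]
    by_cases hxj : x j = y j
    · have : (if β then Pauli.Y else Pauli.X).mat (y j) (x j) = 0 := by
        rw [hxj]; cases β <;> simp
      rw [this, zero_mul, zero_mul]
    · have hex : ∃ i, i ≠ j ∧ x i ≠ y i := by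
        by_contra hno
        push Not at hno
        apply hx
        funext i
        by_cases hi : i = j
        · subst hi
          rw [Function.update_self]
          cases hxi : x i <;> cases hyi : y i <;> simp_all
        · rw [Function.update_of_ne hi]
          exact hno i hi
      obtain ⟨i, hij, hxy⟩ := hex
      have hzero : (if i < j then Pauli.Z else Pauli.I).mat (y i) (x i) = 0 := by
        have : y i ≠ x i := fun h => hxy h.symm
        split_ifs <;> simp [this]
      rw [Finset.prod_eq_zero (Finset.mem_erase.2 ⟨hij, Finset.mem_univ i⟩) hzero, mul_zero, zero_mul]
  · intro h; exact absurd (Finset.mem_univ _) h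

/-! ### Register splitting: last block of four wires -/

/-- Conditional amplitude vector on the first `b` wires given the last-block label `x`. [folklore] -/
def cond4 {b : ℕ} (G : QReg (b + 4) → ℂ) (x : QReg 4) : QReg b → ℂ := fun w => G (Fin.append w x)

/-- The parity sign `(-1)^{|w|}` of the first `b` wires (the Jordan–Wigner string through them). [folklore] -/
def bsign {b : ℕ} (w : QReg b) : ℂ := ∏ i : Fin b, (if w i = true then (-1 : ℂ) else 1)

/-- `bsign w ^ 2 = 1`. [folklore] -/
theorem bsign_sq {b : ℕ} (w : QReg b) : bsign w * bsign w = 1 := by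
  unfold bsign
  rw [← Finset.prod_mul_distrib]
  exact Finset.prod_eq_one fun i _ => by split_ifs <;> norm_num

/-- `star (bsign w) = bsign w` (a real sign). [folklore] -/
theorem star_bsign {b : ℕ} (w : QReg b) : star (bsign w) = bsign w := by
  unfold bsign
  rw [Complex.star_def, map_prod]
  refine Finset.prod_congr rfl fun i _ => ?_
  split_ifs <;> simp

/-- `‖bsign w‖ = 1`. [folklore] -/
theorem norm_bsign {b : ℕ} (w : QReg b) : ‖bsign w‖ = 1 := by
  unfold bsign
  rw [norm_prod]
  exact Finset.prod_eq_one fun i _ => by split_ifs <;> simp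

/-- **`‖G‖² = Σ_x ‖cond4 G x‖²`**. [folklore] -/
theorem normSq_eq_sum_cond4 {b : ℕ} (G : QReg (b + 4) → ℂ) :
    normSq G = ∑ x : QReg 4, normSq (cond4 G x) := by
  unfold normSq cond4
  rw [← Fintype.sum_equiv (Fin.appendEquiv b 4) (fun p => ‖G (Fin.append p.1 p.2)‖ ^ 2)
    (fun z => ‖G z‖ ^ 2) (fun p => rfl), Fintype.sum_prod_type, Finset.sum_comm]

/-- Updating an appended tuple at a left index. [folklore] -/
theorem update_append_castAdd {b : ℕ} (w : QReg b) (x : QReg 4) (i : Fin b) (c : Bool) :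
    Function.update (Fin.append w x) (Fin.castAdd 4 i) c = Fin.append (Function.update w i c) x := by
  funext m
  cases m using Fin.addCases with
  | left i' =>
    rw [Fin.append_left]
    by_cases h : i' = i
    · subst h
      rw [Function.update_self, Function.update_self]
    · rw [Function.update_of_ne (fun h' => h (Fin.castAdd_inj.1 h')), Fin.append_left,
        Function.update_of_ne h]
  | right k =>
    have hne : (Fin.natAdd b k : Fin (b + 4)) ≠ Fin.castAdd 4 i := by
      intro h'; have := congrArg Fin.val h'; simp at this; omega
    rw [Function.update_of_ne hne, Fin.append_right, Fin.append_right]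

/-- Updating an appended tuple at a right index. [folklore] -/
theorem update_append_natAdd {b : ℕ} (w : QReg b) (x : QReg 4) (k : Fin 4) (c : Bool) :
    Function.update (Fin.append w x) (Fin.natAdd b k) c = Fin.append w (Function.update x k c) := by
  funext m
  cases m using Fin.addCases with
  | left i' =>
    have hne : (Fin.castAdd 4 i' : Fin (b + 4)) ≠ Fin.natAdd b k := by
      intro h'; have := congrArg Fin.val h'; simp at this; omega
    rw [Function.update_of_ne hne, Fin.append_left, Fin.append_left]
  | right k' =>
    rw [Fin.append_right]
    by_cases h : k' = k
    · subst h
      rw [Function.update_self, Function.update_self]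
    · have hne : (Fin.natAdd b k' : Fin (b + 4)) ≠ Fin.natAdd b k := by
        intro h'; apply h; have := congrArg Fin.val h'; simp at this; exact Fin.ext (by omega)
      rw [Function.update_of_ne hne, Fin.append_right, Function.update_of_ne h]

/-- Phase of a left-half Majorana on an appended label: independent of the last block. [folklore] -/
theorem majPhase_castAdd {b : ℕ} (i : Fin b) (β : Bool) (w : QReg b) (x : QReg 4) :
    majPhase (Fin.castAdd 4 i) β (Fin.append w x) = majPhase i β w := by
  unfold majPhase
  rw [Fin.append_left, Fin.prod_univ_add]
  have h2 : ∏ k : Fin 4, (if (Fin.natAdd b k : Fin (b + 4)) < Fin.castAdd 4 i ∧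
      Fin.append w x (Fin.natAdd b k) = true then (-1 : ℂ) else 1) = 1 := by
    refine Finset.prod_eq_one fun k _ => ?_
    have : ¬ ((Fin.natAdd b k : Fin (b + 4)) < Fin.castAdd 4 i) := by
      rw [Fin.lt_def]; simp; omega
    simp [this]
  rw [h2, mul_one]
  congr 1
  refine Finset.prod_congr rfl fun i' _ => ?_
  rw [Fin.append_left]
  have : ((Fin.castAdd 4 i' : Fin (b + 4)) < Fin.castAdd 4 i) ↔ i' < i := by
    rw [Fin.lt_def, Fin.lt_def]; simp
  simp only [this]

/-- Phase of a last-block Majorana on an appended label: the parity sign of the left half times the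
four-qubit phase. [folklore] -/
theorem majPhase_natAdd {b : ℕ} (k : Fin 4) (β : Bool) (w : QReg b) (x : QReg 4) :
    majPhase (Fin.natAdd b k) β (Fin.append w x) = bsign w * majPhase k β x := by
  unfold majPhase bsign
  rw [Fin.append_right, Fin.prod_univ_add]
  have h1 : ∏ i' : Fin b, (if (Fin.castAdd 4 i' : Fin (b + 4)) < Fin.natAdd b k ∧
      Fin.append w x (Fin.castAdd 4 i') = true then (-1 : ℂ) else 1) =
      ∏ i' : Fin b, (if w i' = true then (-1 : ℂ) else 1) := by
    refine Finset.prod_congr rfl fun i' _ => ?_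
    have : (Fin.castAdd 4 i' : Fin (b + 4)) < Fin.natAdd b k := by
      rw [Fin.lt_def]; simp; omega
    rw [Fin.append_left]; simp [this]
  have h2 : ∏ k' : Fin 4, (if (Fin.natAdd b k' : Fin (b + 4)) < Fin.natAdd b k ∧
      Fin.append w x (Fin.natAdd b k') = true then (-1 : ℂ) else 1) =
      ∏ k' : Fin 4, (if k' < k ∧ x k' = true then (-1 : ℂ) else 1) := by
    refine Finset.prod_congr rfl fun k' _ => ?_
    rw [Fin.append_right]
    have : ((Fin.natAdd b k' : Fin (b + 4)) < Fin.natAdd b k) ↔ k' < k := Fin.natAdd_lt_natAdd_iff b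
    simp only [this]
  rw [h1, h2]
  ring

/-- **A left-half Majorana acts on the conditional vector.** [folklore] -/
theorem majorana_castAdd_mulVec_append {b : ℕ} (G : QReg (b + 4) → ℂ) (i : Fin b) (β : Bool)
    (w : QReg b) (x : QReg 4) :
    (majorana (b + 4) (Fin.castAdd 4 i) β *ᵥ G) (Fin.append w x) = (majorana b i β *ᵥ cond4 G x) w := by
  rw [majorana_mulVec_apply, majorana_mulVec_apply, majPhase_castAdd, Fin.append_left,
    update_append_castAdd]
  rfl

/-- **A last-block Majorana acts on the four-qubit slice, up to the left parity sign.** [folklore] -/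
theorem majorana_natAdd_mulVec_append {b : ℕ} (G : QReg (b + 4) → ℂ) (k : Fin 4) (β : Bool)
    (w : QReg b) (x : QReg 4) :
    (majorana (b + 4) (Fin.natAdd b k) β *ᵥ G) (Fin.append w x) =
      bsign w * (majorana 4 k β *ᵥ (fun x' => G (Fin.append w x'))) x := by
  rw [majorana_mulVec_apply, majorana_mulVec_apply, majPhase_natAdd, Fin.append_right,
    update_append_natAdd, mul_assoc]

/-! ### The quadratic relations and their heredity under conditioning -/

/-- The **quadratic relations** `Λ(G ⊗ G) = 0`, `Λ = Σ_p c_p ⊗ c_p`, as a property of a vector. [folklore] -/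
def QuadRel {n : ℕ} (G : QReg n → ℂ) : Prop :=
  ∀ u v : QReg n, ∑ p : Fin n × Bool, (majorana n p.1 p.2 *ᵥ G) u * (majorana n p.1 p.2 *ᵥ G) v = 0

/-- Splitting the sum over the Majoranas of `b + 4` wires into the two halves. [folklore] -/
theorem sum_majorana_split {b : ℕ} (f : Fin (b + 4) × Bool → ℂ) :
    ∑ p : Fin (b + 4) × Bool, f p =
      (∑ q : Fin b × Bool, f (Fin.castAdd 4 q.1, q.2)) + ∑ r : Fin 4 × Bool, f (Fin.natAdd b r.1, r.2) := by
  simp only [Fintype.sum_prod_type]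
  exact Fin.sum_univ_add _

/-- **Heredity**: the quadratic relations pass to every last-block conditional (the last-block terms of the
relation at two labels with the SAME last block cancel in `X`/`Y` pairs). [folklore] -/
theorem quadRel_cond4 {b : ℕ} {G : QReg (b + 4) → ℂ} (hG : QuadRel G) (x : QReg 4) :
    QuadRel (cond4 G x) := by
  intro w w'
  have h := hG (Fin.append w x) (Fin.append w' x)
  rw [sum_majorana_split] at h
  simp only [majorana_castAdd_mulVec_append, majorana_natAdd_mulVec_append] at h
  have hA : ∑ r : Fin 4 × Bool, bsign w * (majorana 4 r.1 r.2 *ᵥ fun x' => G (Fin.append w x')) x *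
      (bsign w' * (majorana 4 r.1 r.2 *ᵥ fun x' => G (Fin.append w' x')) x) = 0 := by
    rw [Fintype.sum_prod_type]
    refine Finset.sum_eq_zero fun k _ => ?_
    simp only [Fintype.sum_bool, majorana_mulVec_apply]
    have := majPhase_sq_add k x
    linear_combination (bsign w * bsign w' * G (Fin.append w (Function.update x k (!x k))) *
      G (Fin.append w' (Function.update x k (!x k)))) * this
  rw [hA, add_zero] at h
  exact h

/-! ### CAR norm bounds -/

/-- `‖c(s) ψ‖² ≤ 2 (Σ_q |s_q|²) ‖ψ‖²` (from the CAR: `c(s)ᴴ c(s) = 2ν − c(s) c(s)ᴴ ≤ 2ν`). [folklore] -/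
theorem normSq_majoranaComb_mulVec_le {n : ℕ} (s : Fin n × Bool → ℂ) (ψ : QReg n → ℂ) :
    normSq ((∑ q : Fin n × Bool, s q • majorana n q.1 q.2) *ᵥ ψ) ≤
      2 * (∑ q : Fin n × Bool, ‖s q‖ ^ 2) * normSq ψ := by
  set L := ∑ q : Fin n × Bool, s q • majorana n q.1 q.2 with hL
  set c : ℂ := ((2 * ∑ q : Fin n × Bool, ‖s q‖ ^ 2 : ℝ) : ℂ) with hc
  have hCAR : L * Lᴴ + Lᴴ * L = c • (1 : Matrix (QReg n) (QReg n) ℂ) := by rw [hL, majoranaComb_car]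
  have hLHL : Lᴴ * L = c • (1 : Matrix (QReg n) (QReg n) ℂ) - L * Lᴴ := eq_sub_of_add_eq' hCAR
  have h : star (L *ᵥ ψ) ⬝ᵥ (L *ᵥ ψ) = c * (star ψ ⬝ᵥ ψ) - star (Lᴴ *ᵥ ψ) ⬝ᵥ (Lᴴ *ᵥ ψ) := by
    rw [← star_dotProduct_conjTranspose_mulVec L ψ (L *ᵥ ψ), mulVec_mulVec, hLHL, sub_mulVec,
      smul_mulVec, one_mulVec, ← mulVec_mulVec, dotProduct_sub, dotProduct_smul, smul_eq_mul,
      star_dotProduct_mulVec L ψ (Lᴴ *ᵥ ψ)]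
  rw [star_dotProduct_self_eq_normSq, star_dotProduct_self_eq_normSq,
    star_dotProduct_self_eq_normSq, hc] at h
  have h' : normSq (L *ᵥ ψ) = (2 * ∑ q : Fin n × Bool, ‖s q‖ ^ 2) * normSq ψ - normSq (Lᴴ *ᵥ ψ) := by
    exact_mod_cast h
  have hpos : 0 ≤ normSq (Lᴴ *ᵥ ψ) := Finset.sum_nonneg fun _ _ => by positivity
  linarith

/-- **BILINEAR MAJORANA BOUND**: `|Σ_q ⟨a, c_q φ⟩ ⟨bb, c_q φ'⟩|² ≤ 4 ‖a‖² ‖bb‖² ‖φ‖² ‖φ'‖²`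
(write the sum as `⟨a, c(s) φ⟩` with `s_q = ⟨bb, c_q φ'⟩`, and bound `Σ|s_q|² ≤ 2‖bb‖²‖φ'‖²` the same
way). [folklore] -/
theorem majorana_bilinear_bound {n : ℕ} (a bb φ φ' : QReg n → ℂ) :
    ‖∑ q : Fin n × Bool, (star a ⬝ᵥ (majorana n q.1 q.2 *ᵥ φ)) * (star bb ⬝ᵥ (majorana n q.1 q.2 *ᵥ φ'))‖ ^ 2
      ≤ 4 * normSq a * normSq bb * normSq φ * normSq φ' := by
  set s : Fin n × Bool → ℂ := fun q => star bb ⬝ᵥ (majorana n q.1 q.2 *ᵥ φ') with hs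
  set ν : ℝ := ∑ q : Fin n × Bool, ‖s q‖ ^ 2 with hν
  -- the sum is `⟨a, c(s) φ⟩`
  have hsum : ∑ q : Fin n × Bool, (star a ⬝ᵥ (majorana n q.1 q.2 *ᵥ φ)) * s q =
      star a ⬝ᵥ ((∑ q : Fin n × Bool, s q • majorana n q.1 q.2) *ᵥ φ) := by
    rw [sum_mulVec, dotProduct_sum]
    refine Finset.sum_congr rfl fun q _ => ?_
    rw [smul_mulVec, dotProduct_smul, smul_eq_mul, mul_comm]
  -- `ν ≤ 2 ‖bb‖² ‖φ'‖²`
  have hνC : ((ν : ℝ) : ℂ) = star bb ⬝ᵥ ((∑ q : Fin n × Bool, star (s q) • majorana n q.1 q.2) *ᵥ φ') := by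
    rw [sum_mulVec, dotProduct_sum, hν]
    push_cast
    refine Finset.sum_congr rfl fun q _ => ?_
    rw [smul_mulVec, dotProduct_smul, smul_eq_mul, ← Complex.conj_mul', Complex.star_def]
  have hν0 : 0 ≤ ν := Finset.sum_nonneg fun _ _ => by positivity
  have hbb0 : 0 ≤ normSq bb := Finset.sum_nonneg fun _ _ => by positivity
  have hφ'0 : 0 ≤ normSq φ' := Finset.sum_nonneg fun _ _ => by positivity
  have hνle : ν ≤ 2 * normSq bb * normSq φ' := by
    have h1 : ν ^ 2 ≤ normSq bb * (2 * ν * normSq φ') := by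
      have hcs := norm_star_dotProduct_sq_le bb ((∑ q : Fin n × Bool, star (s q) • majorana n q.1 q.2) *ᵥ φ')
      rw [← hνC, Complex.norm_real, Real.norm_eq_abs, abs_of_nonneg hν0] at hcs
      have hle := normSq_majoranaComb_mulVec_le (fun q => star (s q)) φ'
      have hstar : ∑ q : Fin n × Bool, ‖star (s q)‖ ^ 2 = ν := by
        rw [hν]; refine Finset.sum_congr rfl fun q _ => ?_; rw [norm_star]
      rw [hstar] at hle
      exact hcs.trans (mul_le_mul_of_nonneg_left hle hbb0)
    by_cases hz : ν = 0
    · rw [hz]; positivity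
    · have hνpos : 0 < ν := lt_of_le_of_ne hν0 (Ne.symm hz)
      nlinarith
  -- Cauchy–Schwarz on `⟨a, c(s) φ⟩`
  have ha0 : 0 ≤ normSq a := Finset.sum_nonneg fun _ _ => by positivity
  have hφ0 : 0 ≤ normSq φ := Finset.sum_nonneg fun _ _ => by positivity
  rw [hsum]
  calc ‖star a ⬝ᵥ ((∑ q : Fin n × Bool, s q • majorana n q.1 q.2) *ᵥ φ)‖ ^ 2
      ≤ normSq a * normSq ((∑ q : Fin n × Bool, s q • majorana n q.1 q.2) *ᵥ φ) :=
        norm_star_dotProduct_sq_le _ _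
    _ ≤ normSq a * (2 * ν * normSq φ) :=
        mul_le_mul_of_nonneg_left (normSq_majoranaComb_mulVec_le s φ) ha0
    _ ≤ normSq a * (2 * (2 * normSq bb * normSq φ') * normSq φ) := by gcongr
    _ = 4 * normSq a * normSq bb * normSq φ * normSq φ' := by ring

/-! ### The corner lemma for vectors satisfying the quadratic relations -/

/-- Bit strings of the last block. [folklore] -/
def s0000 : QReg 4 := fun _ => false
/-- [folklore] -/
def s1111 : QReg 4 := fun _ => true
/-- [folklore] -/
def s1000 : QReg 4 := ![true, false, false, false]
/-- [folklore] -/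
def s0111 : QReg 4 := ![false, true, true, true]
/-- The flips of `1000` at position `k`: `0000, 1100, 1010, 1001`. [folklore] -/
def fA : Fin 4 → QReg 4 := ![s0000, ![true, true, false, false], ![true, false, true, false], ![true, false, false, true]]
/-- The flips of `0111` at position `k`: `1111, 0011, 0101, 0110` (complements of `fA k`). [folklore] -/
def fB : Fin 4 → QReg 4 := ![s1111, ![false, false, true, true], ![false, true, false, true], ![false, true, true, false]]

/-- [folklore] -/
theorem update_s1000 (k : Fin 4) : Function.update s1000 k (!s1000 k) = fA k := by
  fin_cases k <;> decide

/-- [folklore] -/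
theorem update_s0111 (k : Fin 4) : Function.update s0111 k (!s0111 k) = fB k := by
  fin_cases k <;> decide

/-- The coefficients of the last-block part of the relation: `θ_k = Σ_β majPhase k β 1000 · majPhase k β 0111`.
[folklore] -/
def theta (k : Fin 4) : ℂ :=
  majPhase k false s1000 * majPhase k false s0111 + majPhase k true s1000 * majPhase k true s0111

/-- `θ_0 = 2`. [folklore] -/
theorem theta_zero : theta 0 = 2 := by
  simp [theta, majPhase, s1000, s0111]
  norm_num

/-- `‖θ_k‖ ≤ 2`. [folklore] -/
theorem norm_theta_le (k : Fin 4) : ‖theta k‖ ≤ 2 := by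
  unfold theta
  refine (norm_add_le _ _).trans ?_
  rw [norm_mul, norm_mul, norm_majPhase, norm_majPhase, norm_majPhase, norm_majPhase]
  norm_num

/-- **The quadratic relation at the corner pair** `(w·1000, w'·0111)`: left-half part plus
`(-1)^{|w|+|w'|} Σ_k θ_k G(w, fA k) G(w', fB k)`. [folklore] -/
theorem corner_relation {b : ℕ} {G : QReg (b + 4) → ℂ} (hG : QuadRel G) (w w' : QReg b) :
    (∑ q : Fin b × Bool, (majorana b q.1 q.2 *ᵥ cond4 G s1000) w * (majorana b q.1 q.2 *ᵥ cond4 G s0111) w') +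
      bsign w * bsign w' * ∑ k : Fin 4, theta k * (cond4 G (fA k) w * cond4 G (fB k) w') = 0 := by
  have h := hG (Fin.append w s1000) (Fin.append w' s0111)
  rw [sum_majorana_split] at h
  have hB : (∑ q : Fin b × Bool, (majorana (b + 4) (Fin.castAdd 4 q.1) q.2 *ᵥ G) (Fin.append w s1000) *
      (majorana (b + 4) (Fin.castAdd 4 q.1) q.2 *ᵥ G) (Fin.append w' s0111)) =
      ∑ q : Fin b × Bool, (majorana b q.1 q.2 *ᵥ cond4 G s1000) w * (majorana b q.1 q.2 *ᵥ cond4 G s0111) w' :=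
    Finset.sum_congr rfl fun q _ => by rw [majorana_castAdd_mulVec_append, majorana_castAdd_mulVec_append]
  have hA : (∑ r : Fin 4 × Bool, (majorana (b + 4) (Fin.natAdd b r.1) r.2 *ᵥ G) (Fin.append w s1000) *
      (majorana (b + 4) (Fin.natAdd b r.1) r.2 *ᵥ G) (Fin.append w' s0111)) =
      bsign w * bsign w' * ∑ k : Fin 4, theta k * (cond4 G (fA k) w * cond4 G (fB k) w') := by
    rw [Fintype.sum_prod_type, Finset.mul_sum]
    refine Finset.sum_congr rfl fun k _ => ?_
    rw [Fintype.sum_bool, majorana_natAdd_mulVec_append, majorana_natAdd_mulVec_append,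
      majorana_natAdd_mulVec_append, majorana_natAdd_mulVec_append, majorana_mulVec_apply,
      majorana_mulVec_apply, majorana_mulVec_apply, majorana_mulVec_apply, update_s1000, update_s0111]
    unfold theta cond4
    ring
  rw [hB, hA] at h
  exact h

/-- Triple-sum bookkeeping: `Σ_w Σ_w' α_w β_w' Σ_k c_k u_k(w) v_k(w') = Σ_k c_k (Σ_w α_w u_k w)(Σ_w' β_w' v_k w')`.
[folklore] -/
theorem sum_sum_mul_sum {ι κ : Type*} [Fintype ι] [Fintype κ] (α β : ι → ℂ) (c : κ → ℂ)
    (u v : κ → ι → ℂ) :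
    ∑ w : ι, ∑ w' : ι, α w * β w' * ∑ k : κ, c k * (u k w * v k w') =
      ∑ k : κ, c k * ((∑ w : ι, α w * u k w) * ∑ w' : ι, β w' * v k w') := by
  calc ∑ w : ι, ∑ w' : ι, α w * β w' * ∑ k : κ, c k * (u k w * v k w')
      = ∑ w : ι, ∑ w' : ι, ∑ k : κ, c k * ((α w * u k w) * (β w' * v k w')) := by
        refine Finset.sum_congr rfl fun w _ => Finset.sum_congr rfl fun w' _ => ?_
        rw [Finset.mul_sum]
        exact Finset.sum_congr rfl fun k _ => by ring
    _ = ∑ w : ι, ∑ k : κ, ∑ w' : ι, c k * ((α w * u k w) * (β w' * v k w')) :=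
        Finset.sum_congr rfl fun w _ => Finset.sum_comm
    _ = ∑ k : κ, ∑ w : ι, ∑ w' : ι, c k * ((α w * u k w) * (β w' * v k w')) := Finset.sum_comm
    _ = ∑ k : κ, c k * ((∑ w : ι, α w * u k w) * ∑ w' : ι, β w' * v k w') := by
        refine Finset.sum_congr rfl fun k _ => ?_
        rw [Finset.sum_mul_sum, Finset.mul_sum]
        refine Finset.sum_congr rfl fun w _ => ?_
        rw [Finset.mul_sum]

/-- **The paired relation**: with `a = G(·,0000)`, `bb = G(·,1111)`, `φ = G(·,1000)`, `φ' = G(·,0111)` and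
the sign-twisted `ã = (-1)^{|w|} a`, `b̃ = (-1)^{|w|} bb`:
`Σ_q ⟨ã, c_q φ⟩ ⟨b̃, c_q φ'⟩ + Σ_k θ_k ⟨a, G(·,fA k)⟩ ⟨bb, G(·,fB k)⟩ = 0`. [folklore] -/
theorem corner_pairing {b : ℕ} {G : QReg (b + 4) → ℂ} (hG : QuadRel G) :
    (∑ q : Fin b × Bool, (star (fun w => bsign w * cond4 G s0000 w) ⬝ᵥ (majorana b q.1 q.2 *ᵥ cond4 G s1000)) *
        (star (fun w => bsign w * cond4 G s1111 w) ⬝ᵥ (majorana b q.1 q.2 *ᵥ cond4 G s0111))) +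
      ∑ k : Fin 4, theta k * ((star (cond4 G s0000) ⬝ᵥ cond4 G (fA k)) * (star (cond4 G s1111) ⬝ᵥ cond4 G (fB k))) = 0 := by
  set α : QReg b → ℂ := fun w => star (bsign w * cond4 G s0000 w) with hα
  set β : QReg b → ℂ := fun w => star (bsign w * cond4 G s1111 w) with hβ
  have hrel := corner_relation hG
  -- multiply the relation at (w, w') by α w * β w' and sum
  have hzero : ∑ w : QReg b, ∑ w' : QReg b, α w * β w' *
      ((∑ q : Fin b × Bool, (majorana b q.1 q.2 *ᵥ cond4 G s1000) w * (majorana b q.1 q.2 *ᵥ cond4 G s0111) w') +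
        bsign w * bsign w' * ∑ k : Fin 4, theta k * (cond4 G (fA k) w * cond4 G (fB k) w')) = 0 :=
    Finset.sum_eq_zero fun w _ => Finset.sum_eq_zero fun w' _ => by rw [hrel w w', mul_zero]
  -- expand
  have hsplit : ∀ w w' : QReg b, α w * β w' *
      ((∑ q : Fin b × Bool, (majorana b q.1 q.2 *ᵥ cond4 G s1000) w * (majorana b q.1 q.2 *ᵥ cond4 G s0111) w') +
        bsign w * bsign w' * ∑ k : Fin 4, theta k * (cond4 G (fA k) w * cond4 G (fB k) w')) =
      α w * β w' * (∑ q : Fin b × Bool, (1 : ℂ) * ((majorana b q.1 q.2 *ᵥ cond4 G s1000) w *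
        (majorana b q.1 q.2 *ᵥ cond4 G s0111) w')) +
      (α w * bsign w) * (β w' * bsign w') * ∑ k : Fin 4, theta k * (cond4 G (fA k) w * cond4 G (fB k) w') := by
    intro w w'
    simp only [one_mul]
    ring
  simp_rw [hsplit] at hzero
  rw [Finset.sum_congr rfl fun w _ => Finset.sum_add_distrib, Finset.sum_add_distrib,
    sum_sum_mul_sum, sum_sum_mul_sum] at hzero
  -- identify the two pieces
  have hαs : ∀ w, α w * bsign w = star (cond4 G s0000 w) := by
    intro w
    rw [hα]
    simp only [star_mul', star_bsign]
    rw [mul_comm (bsign w) _, mul_assoc, bsign_sq, mul_one]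
  have hβs : ∀ w, β w * bsign w = star (cond4 G s1111 w) := by
    intro w
    rw [hβ]
    simp only [star_mul', star_bsign]
    rw [mul_comm (bsign w) _, mul_assoc, bsign_sq, mul_one]
  simp only [one_mul, hαs, hβs] at hzero
  convert hzero using 2
  · refine Finset.sum_congr rfl fun q _ => ?_
    rfl
  · refine Finset.sum_congr rfl fun k _ => ?_
    rfl

/-! ### Assembly of the corner lemma -/

/-- `0 ≤ normSq`. [folklore] -/
theorem normSq_nonneg' {n : ℕ} (ψ : QReg n → ℂ) : 0 ≤ normSq ψ :=
  Finset.sum_nonneg fun _ _ => by positivity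

/-- `|⟨a, c⟩| ≤ ‖a‖ ‖c‖` with square roots of `normSq`. [folklore] -/
theorem norm_star_dotProduct_le_sqrt {n : ℕ} (a c : QReg n → ℂ) :
    ‖star a ⬝ᵥ c‖ ≤ Real.sqrt (normSq a) * Real.sqrt (normSq c) := by
  rw [← Real.sqrt_mul (normSq_nonneg' a), ← Real.sqrt_sq (norm_nonneg (star a ⬝ᵥ c))]
  exact Real.sqrt_le_sqrt (norm_star_dotProduct_sq_le a c)

/-- Twisting by the parity sign does not change the norm. [folklore] -/
theorem normSq_bsign_mul {b : ℕ} (f : QReg b → ℂ) : normSq (fun w => bsign w * f w) = normSq f := by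
  unfold normSq
  refine Finset.sum_congr rfl fun w _ => ?_
  rw [norm_mul, norm_bsign, one_mul]

/-- AM–GM for square roots: `√(x y) ≤ (x + y)/2`. [folklore] -/
theorem sqrt_mul_le_half {x y : ℝ} (hx : 0 ≤ x) (hy : 0 ≤ y) : Real.sqrt (x * y) ≤ (x + y) / 2 := by
  rw [show (x + y) / 2 = Real.sqrt (((x + y) / 2) ^ 2) by rw [Real.sqrt_sq (by positivity)]]
  exact Real.sqrt_le_sqrt (by nlinarith [sq_nonneg (x - y)])

/-- The ten last-block strings used are distinct: their conditional masses add up to at most `‖G‖²`.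
[folklore] -/
theorem ten_le_normSq {b : ℕ} (G : QReg (b + 4) → ℂ) :
    normSq (cond4 G s0000) + normSq (cond4 G s1111) +
      ((normSq (cond4 G (fA 1)) + normSq (cond4 G (fB 1))) + (normSq (cond4 G (fA 2)) + normSq (cond4 G (fB 2))) +
        (normSq (cond4 G (fA 3)) + normSq (cond4 G (fB 3)))) +
      (normSq (cond4 G s1000) + normSq (cond4 G s0111)) ≤ normSq G := by
  classical
  rw [normSq_eq_sum_cond4]
  set N : QReg 4 → ℝ := fun x => normSq (cond4 G x) with hN
  have hN0 : ∀ x, 0 ≤ N x := fun x => normSq_nonneg' _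
  have key : ∑ x ∈ ({s0000, s1111, fA 1, fB 1, fA 2, fB 2, fA 3, fB 3, s1000, s0111} : Finset (QReg 4)), N x =
      N s0000 + N s1111 + ((N (fA 1) + N (fB 1)) + (N (fA 2) + N (fB 2)) + (N (fA 3) + N (fB 3))) +
        (N s1000 + N s0111) := by
    rw [Finset.sum_insert (by decide), Finset.sum_insert (by decide), Finset.sum_insert (by decide),
      Finset.sum_insert (by decide), Finset.sum_insert (by decide), Finset.sum_insert (by decide),
      Finset.sum_insert (by decide), Finset.sum_insert (by decide), Finset.sum_insert (by decide),
      Finset.sum_singleton]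
    ring
  calc N s0000 + N s1111 + ((N (fA 1) + N (fB 1)) + (N (fA 2) + N (fB 2)) + (N (fA 3) + N (fB 3))) +
        (N s1000 + N s0111)
      = ∑ x ∈ ({s0000, s1111, fA 1, fB 1, fA 2, fB 2, fA 3, fB 3, s1000, s0111} : Finset (QReg 4)), N x :=
        key.symm
    _ ≤ ∑ x, N x := Finset.sum_le_univ_sum_of_nonneg hN0

/-- **THE CORNER LEMMA.** For every vector `G` on `b + 4` wires satisfying the quadratic relations (in
particular every Gaussian state), the conditional vectors at the two corners `0000`, `1111` of the last
block satisfy `‖G(·,0000)‖ + ‖G(·,1111)‖ ≤ ‖G‖`. (At `b = 0` this is `|g₀| + |g₁₅| ≤ ‖g‖`, Cudby–Strelchuk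
Lemma 1.) [folklore] -/
theorem corner_lemma {b : ℕ} {G : QReg (b + 4) → ℂ} (hG : QuadRel G) :
    Real.sqrt (normSq (cond4 G s0000)) + Real.sqrt (normSq (cond4 G s1111)) ≤ Real.sqrt (normSq G) := by
  -- abbreviations
  set a := cond4 G s0000 with ha
  set bb := cond4 G s1111 with hbb
  set Na := normSq a with hNa
  set Nb := normSq bb with hNb
  have hNa0 : 0 ≤ Na := normSq_nonneg' _
  have hNb0 : 0 ≤ Nb := normSq_nonneg' _
  have hten := ten_le_normSq G
  -- the paired relation, with the k = 0 term isolated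
  have hpair := corner_pairing hG
  rw [Fin.sum_univ_four, theta_zero] at hpair
  have h0 : (star (cond4 G s0000) ⬝ᵥ cond4 G (fA 0)) * (star (cond4 G s1111) ⬝ᵥ cond4 G (fB 0)) =
      ((Na * Nb : ℝ) : ℂ) := by
    show (star a ⬝ᵥ a) * (star bb ⬝ᵥ bb) = _
    rw [star_dotProduct_self_eq_normSq, star_dotProduct_self_eq_normSq]
    push_cast
    ring
  rw [h0] at hpair
  -- complex quantities
  set Bt := ∑ q : Fin b × Bool, (star (fun w => bsign w * cond4 G s0000 w) ⬝ᵥ (majorana b q.1 q.2 *ᵥ cond4 G s1000)) *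
    (star (fun w => bsign w * cond4 G s1111 w) ⬝ᵥ (majorana b q.1 q.2 *ᵥ cond4 G s0111)) with hBt
  set A : Fin 4 → ℂ := fun k => star (cond4 G s0000) ⬝ᵥ cond4 G (fA k) with hA
  set B : Fin 4 → ℂ := fun k => star (cond4 G s1111) ⬝ᵥ cond4 G (fB k) with hB
  have hiso : (((2 : ℝ) * (Na * Nb) : ℝ) : ℂ) = -(Bt + theta 1 * (A 1 * B 1) + theta 2 * (A 2 * B 2) +
      theta 3 * (A 3 * B 3)) := by
    push_cast at hpair ⊢
    linear_combination hpair
  -- norm bounds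
  set Sφ := Real.sqrt (normSq (cond4 G s1000)) * Real.sqrt (normSq (cond4 G s0111)) with hSφ
  set P := Real.sqrt Na * Real.sqrt Nb with hP
  have hP0 : 0 ≤ P := by positivity
  have hSφ0 : 0 ≤ Sφ := by positivity
  have hBt : ‖Bt‖ ≤ 2 * P * Sφ := by
    have h := majorana_bilinear_bound (fun w => bsign w * cond4 G s0000 w) (fun w => bsign w * cond4 G s1111 w)
      (cond4 G s1000) (cond4 G s0111)
    rw [normSq_bsign_mul, normSq_bsign_mul] at h
    have h' : ‖Bt‖ ^ 2 ≤ (2 * P * Sφ) ^ 2 := by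
      have e : (2 * P * Sφ) ^ 2 = 4 * normSq (cond4 G s0000) * normSq (cond4 G s1111) *
          normSq (cond4 G s1000) * normSq (cond4 G s0111) := by
        rw [hP, hSφ, hNa, hNb, ha, hbb, mul_pow, mul_pow, mul_pow, mul_pow,
          Real.sq_sqrt (normSq_nonneg' _), Real.sq_sqrt (normSq_nonneg' _),
          Real.sq_sqrt (normSq_nonneg' _), Real.sq_sqrt (normSq_nonneg' _)]
        ring
      rw [e]
      exact h
    calc ‖Bt‖ = Real.sqrt (‖Bt‖ ^ 2) := (Real.sqrt_sq (norm_nonneg _)).symm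
      _ ≤ Real.sqrt ((2 * P * Sφ) ^ 2) := Real.sqrt_le_sqrt h'
      _ = 2 * P * Sφ := Real.sqrt_sq (by positivity)
  have hAk : ∀ k, ‖A k‖ ≤ Real.sqrt Na * Real.sqrt (normSq (cond4 G (fA k))) := fun k =>
    norm_star_dotProduct_le_sqrt _ _
  have hBk : ∀ k, ‖B k‖ ≤ Real.sqrt Nb * Real.sqrt (normSq (cond4 G (fB k))) := fun k =>
    norm_star_dotProduct_le_sqrt _ _
  have hABk : ∀ k, ‖theta k * (A k * B k)‖ ≤
      2 * P * (Real.sqrt (normSq (cond4 G (fA k))) * Real.sqrt (normSq (cond4 G (fB k)))) := by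
    intro k
    rw [norm_mul, norm_mul]
    have h1 := norm_theta_le k
    have h2 := hAk k
    have h3 := hBk k
    have h4 : ‖A k‖ * ‖B k‖ ≤ (Real.sqrt Na * Real.sqrt (normSq (cond4 G (fA k)))) *
        (Real.sqrt Nb * Real.sqrt (normSq (cond4 G (fB k)))) :=
      mul_le_mul h2 h3 (norm_nonneg _) (by positivity)
    calc ‖theta k‖ * (‖A k‖ * ‖B k‖)
        ≤ 2 * ((Real.sqrt Na * Real.sqrt (normSq (cond4 G (fA k)))) *
          (Real.sqrt Nb * Real.sqrt (normSq (cond4 G (fB k))))) :=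
          mul_le_mul h1 h4 (by positivity) (by norm_num)
      _ = 2 * P * (Real.sqrt (normSq (cond4 G (fA k))) * Real.sqrt (normSq (cond4 G (fB k)))) := by
          rw [hP]; ring
  -- the main inequality `2 Na Nb ≤ 2 P Q`
  set Q := Sφ + (Real.sqrt (normSq (cond4 G (fA 1))) * Real.sqrt (normSq (cond4 G (fB 1))) +
    Real.sqrt (normSq (cond4 G (fA 2))) * Real.sqrt (normSq (cond4 G (fB 2))) +
    Real.sqrt (normSq (cond4 G (fA 3))) * Real.sqrt (normSq (cond4 G (fB 3)))) with hQ
  have hmain : 2 * (Na * Nb) ≤ 2 * P * Q := by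
    have hn : 2 * (Na * Nb) = ‖(((2 : ℝ) * (Na * Nb) : ℝ) : ℂ)‖ := by
      rw [Complex.norm_real, Real.norm_eq_abs, abs_of_nonneg (by positivity)]
    rw [hn, hiso, norm_neg]
    calc ‖Bt + theta 1 * (A 1 * B 1) + theta 2 * (A 2 * B 2) + theta 3 * (A 3 * B 3)‖
        ≤ ‖Bt‖ + ‖theta 1 * (A 1 * B 1)‖ + ‖theta 2 * (A 2 * B 2)‖ + ‖theta 3 * (A 3 * B 3)‖ := by
          refine (norm_add_le _ _).trans ?_
          refine add_le_add ((norm_add_le _ _).trans (add_le_add (norm_add_le _ _) le_rfl)) le_rfl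
      _ ≤ 2 * P * Sφ + 2 * P * (Real.sqrt (normSq (cond4 G (fA 1))) * Real.sqrt (normSq (cond4 G (fB 1)))) +
          2 * P * (Real.sqrt (normSq (cond4 G (fA 2))) * Real.sqrt (normSq (cond4 G (fB 2)))) +
          2 * P * (Real.sqrt (normSq (cond4 G (fA 3))) * Real.sqrt (normSq (cond4 G (fB 3)))) :=
          add_le_add (add_le_add (add_le_add hBt (hABk 1)) (hABk 2)) (hABk 3)
      _ = 2 * P * Q := by rw [hQ]; ring
  -- `Q ≤ (‖G‖² − Na − Nb)/2`
  have hQle : Q ≤ (normSq G - Na - Nb) / 2 := by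
    have e1 : Sφ ≤ (normSq (cond4 G s1000) + normSq (cond4 G s0111)) / 2 := by
      rw [hSφ, ← Real.sqrt_mul (normSq_nonneg' _)]
      exact sqrt_mul_le_half (normSq_nonneg' _) (normSq_nonneg' _)
    have e2 : ∀ k, Real.sqrt (normSq (cond4 G (fA k))) * Real.sqrt (normSq (cond4 G (fB k))) ≤
        (normSq (cond4 G (fA k)) + normSq (cond4 G (fB k))) / 2 := by
      intro k
      rw [← Real.sqrt_mul (normSq_nonneg' _)]
      exact sqrt_mul_le_half (normSq_nonneg' _) (normSq_nonneg' _)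
    have := e2 1; have := e2 2; have := e2 3
    rw [hQ]
    rw [← ha, ← hbb, ← hNa, ← hNb] at hten
    linarith
  -- hence `P ≤ (‖G‖² − Na − Nb)/2`
  have hPsq : P * P = Na * Nb := by
    rw [hP]
    calc Real.sqrt Na * Real.sqrt Nb * (Real.sqrt Na * Real.sqrt Nb)
        = (Real.sqrt Na * Real.sqrt Na) * (Real.sqrt Nb * Real.sqrt Nb) := by ring
      _ = Na * Nb := by rw [Real.mul_self_sqrt hNa0, Real.mul_self_sqrt hNb0]
  have hR0 : 0 ≤ (normSq G - Na - Nb) / 2 := by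
    have : 0 ≤ Q := by rw [hQ]; positivity
    linarith
  have hPle : P ≤ (normSq G - Na - Nb) / 2 := by
    by_cases hPz : P = 0
    · rw [hPz]; exact hR0
    · have hPpos : 0 < P := lt_of_le_of_ne hP0 (Ne.symm hPz)
      have : P ≤ Q := by nlinarith
      exact this.trans hQle
  -- conclude
  have hsq : (Real.sqrt Na + Real.sqrt Nb) ^ 2 ≤ normSq G := by
    calc (Real.sqrt Na + Real.sqrt Nb) ^ 2 = Na + Nb + 2 * P := by
          rw [hP, add_sq, Real.sq_sqrt hNa0, Real.sq_sqrt hNb0]; ring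
      _ ≤ normSq G := by linarith
  calc Real.sqrt Na + Real.sqrt Nb = Real.sqrt ((Real.sqrt Na + Real.sqrt Nb) ^ 2) :=
        (Real.sqrt_sq (by positivity)).symm
    _ ≤ Real.sqrt (normSq G) := Real.sqrt_le_sqrt hsq

/-! ### Quadratic relations of Gaussian states (from G4) -/

/-- **Bilinear CAR** for Majorana combinations: `c(u) c(v) + c(v) c(u) = 2 (u ⬝ᵥ v) · 1`. [folklore] -/
theorem majoranaComb_anticomm {n : ℕ} (u v : Fin n × Bool → ℂ) :
    (∑ p : Fin n × Bool, u p • majorana n p.1 p.2) * (∑ p : Fin n × Bool, v p • majorana n p.1 p.2) +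
      (∑ p : Fin n × Bool, v p • majorana n p.1 p.2) * (∑ p : Fin n × Bool, u p • majorana n p.1 p.2) =
      (2 * (u ⬝ᵥ v)) • (1 : Matrix (QReg n) (QReg n) ℂ) := by
  rw [Finset.sum_mul_sum, Finset.sum_mul_sum, Finset.sum_comm (s := Finset.univ)
    (t := Finset.univ) (f := fun p q => v p • majorana n p.1 p.2 * (u q • majorana n q.1 q.2)),
    ← Finset.sum_add_distrib]
  have hterm : ∀ p : Fin n × Bool, (∑ q : Fin n × Bool, u p • majorana n p.1 p.2 * (v q • majorana n q.1 q.2)) +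
      (∑ q : Fin n × Bool, v q • majorana n q.1 q.2 * (u p • majorana n p.1 p.2)) =
      (u p * v p) • ((2 : ℂ) • (1 : Matrix (QReg n) (QReg n) ℂ)) := by
    intro p
    rw [← Finset.sum_add_distrib]
    have : ∀ q : Fin n × Bool, u p • majorana n p.1 p.2 * (v q • majorana n q.1 q.2) +
        v q • majorana n q.1 q.2 * (u p • majorana n p.1 p.2) =
        (u p * v q) • (if p = q then (2 : ℂ) • (1 : Matrix (QReg n) (QReg n) ℂ) else 0) := by
      intro q
      rw [smul_mul_smul_comm, smul_mul_smul_comm, mul_comm (v q) (u p), ← smul_add,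
        majorana_anticommutator]
    simp_rw [this]
    rw [Finset.sum_eq_single p]
    · rw [if_pos rfl]
    · intro q _ hq
      rw [if_neg (Ne.symm hq), smul_zero]
    · intro h; exact absurd (Finset.mem_univ p) h
  simp_rw [hterm]
  rw [← Finset.sum_smul, smul_smul]
  congr 1
  simp only [dotProduct, Finset.mul_sum, Finset.sum_mul]
  exact Finset.sum_congr rfl (fun p _ => by ring)

/-- Evaluation of a Majorana combination: `(c(w) G) v = w ⬝ᵥ (p ↦ (c_p G) v)`. [folklore] -/
theorem majoranaComb_mulVec_apply {n : ℕ} (w : Fin n × Bool → ℂ) (G : QReg n → ℂ) (v : QReg n) :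
    ((∑ p : Fin n × Bool, w p • majorana n p.1 p.2) *ᵥ G) v =
      w ⬝ᵥ (fun p => (majorana n p.1 p.2 *ᵥ G) v) := by
  rw [sum_mulVec, Finset.sum_apply, dotProduct]
  refine Finset.sum_congr rfl fun p _ => ?_
  rw [smul_mulVec, Pi.smul_apply, smul_eq_mul]

/-- **The annihilator rows of a Gaussian state are ISOTROPIC** for the bilinear dot product:
`A k ⬝ᵥ A k' = 0` (both `c(A k)` and `c(A k')` kill `G ≠ 0`, and `c(u)c(v) + c(v)c(u) = 2(u ⬝ᵥ v)·1`).
[cite: DiasKoenig2024, §2.3] -/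
theorem annihilator_rows_isotropic {n : ℕ} {G : QReg n → ℂ} (hG0 : G ≠ 0)
    (A : Fin n → (Fin n × Bool → ℂ))
    (hann : ∀ k, (∑ p : Fin n × Bool, A k p • majorana n p.1 p.2) *ᵥ G = 0) (k k' : Fin n) :
    A k ⬝ᵥ A k' = 0 := by
  have h := congrArg (fun M => M *ᵥ G) (majoranaComb_anticomm (A k) (A k'))
  simp only [add_mulVec, ← mulVec_mulVec, hann, mulVec_zero, zero_add, smul_mulVec, one_mulVec] at h
  -- h : 0 = (2 * (A k ⬝ᵥ A k')) • G
  obtain ⟨x, hx⟩ : ∃ x, G x ≠ 0 := by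
    by_contra hno
    push Not at hno
    exact hG0 (funext hno)
  have hx' := congrFun h x
  simp only [Pi.zero_apply, Pi.smul_apply, smul_eq_mul] at hx'
  have : 2 * (A k ⬝ᵥ A k') = 0 := by
    rcases mul_eq_zero.1 hx'.symm with h2 | h2
    · exact h2
    · exact absurd h2 hx
  simpa using this

/-- **A maximal isotropic (annihilator) row space is its own orthogonal**: if the `n` rows `A k` of
`ℂ^{2n}` are linearly independent and pairwise isotropic, then every `y` with `A k ⬝ᵥ y = 0` for all `k`
lies in their span (`L ⊆ L^⊥` and `dim L^⊥ = 2n − n = n = dim L`). [cite: DiasKoenig2024, §2.3] -/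
theorem mem_span_of_dotProduct_annihilators_eq_zero {n : ℕ} (A : Fin n → (Fin n × Bool → ℂ))
    (hA : LinearIndependent ℂ A) (hiso : ∀ k k', A k ⬝ᵥ A k' = 0)
    (y : Fin n × Bool → ℂ) (hy : ∀ k, A k ⬝ᵥ y = 0) :
    y ∈ Submodule.span ℂ (Set.range A) := by
  classical
  let M : Matrix (Fin n) (Fin n × Bool) ℂ := Matrix.of A
  let K : Submodule ℂ (Fin n × Bool → ℂ) := LinearMap.ker M.mulVecLin
  have hK : ∀ z, z ∈ K ↔ ∀ k, A k ⬝ᵥ z = 0 := by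
    intro z
    rw [LinearMap.mem_ker, Matrix.mulVecLin_apply]
    constructor
    · intro h k
      have := congrFun h k
      simpa [Matrix.mulVec, M] using this
    · intro h
      funext k
      simpa [Matrix.mulVec, M] using h k
  let W : Submodule ℂ (Fin n × Bool → ℂ) := Submodule.span ℂ (Set.range A)
  have hWK : W ≤ K := by
    rw [Submodule.span_le]
    rintro _ ⟨k', rfl⟩
    exact (hK _).2 fun k => hiso k k'
  have hW : Module.finrank ℂ W = n := by
    rw [finrank_span_eq_card hA, Fintype.card_fin]
  have hrank : M.rank = n := by
    have : LinearIndependent ℂ M.row := hA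
    rw [this.rank_matrix, Fintype.card_fin]
  have hKdim : Module.finrank ℂ K = n := by
    have h := LinearMap.finrank_range_add_finrank_ker M.mulVecLin
    rw [Module.finrank_fintype_fun_eq_card, Fintype.card_prod, Fintype.card_fin, Fintype.card_bool] at h
    have hr : Module.finrank ℂ (LinearMap.range M.mulVecLin) = n := hrank
    rw [hr] at h
    change n + Module.finrank ℂ K = n * 2 at h
    omega
  have hEq : W = K := Submodule.eq_of_le_of_finrank_eq hWK (by rw [hW, hKdim])
  have : y ∈ K := (hK y).2 hy
  rwa [← hEq] at this

/-- **QUADRATIC RELATIONS OF A GAUSSIAN STATE** (`Λ(G ⊗ G) = 0`, `Λ = Σ_p c_p ⊗ c_p`; Cartan's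
pure-spinor relations, the Plücker-type equations of the spinor variety): for every Gaussian `G` and all
basis labels `u, v`,  `Σ_p (c_p G)(u) · (c_p G)(v) = 0`.
Proof from the annihilator definition alone: the vector `y_p := (c_p G)(v)` satisfies
`A k ⬝ᵥ y = (c(A k) G)(v) = 0` for every annihilator row, hence lies in their span (the row space is
its own orthogonal), and the functional `z ↦ Σ_p (c_p G)(u) z_p` kills every annihilator row for the same
reason. [cite: Bravyi2005, Thm. 1 (Λ-characterisation of Gaussian states)] -/
theorem isGaussian_quadRel {n : ℕ} {G : QReg n → ℂ} (hG : IsGaussian G) (u v : QReg n) :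
    ∑ p : Fin n × Bool, (majorana n p.1 p.2 *ᵥ G) u * (majorana n p.1 p.2 *ᵥ G) v = 0 := by
  obtain ⟨hG0, A, hA, hann⟩ := hG
  set x : Fin n × Bool → ℂ := fun p => (majorana n p.1 p.2 *ᵥ G) u with hx
  set y : Fin n × Bool → ℂ := fun p => (majorana n p.1 p.2 *ᵥ G) v with hy
  change x ⬝ᵥ y = 0
  have hAy : ∀ k, A k ⬝ᵥ y = 0 := fun k => by
    rw [hy, ← majoranaComb_mulVec_apply, hann k, Pi.zero_apply]
  have hAx : ∀ k, A k ⬝ᵥ x = 0 := fun k => by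
    rw [hx, ← majoranaComb_mulVec_apply, hann k, Pi.zero_apply]
  have hiso := annihilator_rows_isotropic hG0 A hann
  have hmem := mem_span_of_dotProduct_annihilators_eq_zero A hA hiso y hAy
  -- the functional `z ↦ x ⬝ᵥ z` vanishes on the span of the rows
  refine Submodule.span_induction (p := fun z _ => x ⬝ᵥ z = 0) ?_ ?_ ?_ ?_ hmem
  · rintro _ ⟨k, rfl⟩
    rw [dotProduct_comm]
    exact hAx k
  · exact dotProduct_zero _
  · intro z z' _ _ hz hz'
    rw [dotProduct_add, hz, hz', add_zero]
  · intro c z _ hz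
    rw [dotProduct_smul, hz, smul_zero]

/-- Gaussian states satisfy `QuadRel`. [cite: Bravyi2005, Thm. 1] -/
theorem IsGaussian.quadRel {n : ℕ} {G : QReg n → ℂ} (hG : IsGaussian G) : QuadRel G :=
  fun u v => isGaussian_quadRel hG u v

/-! ### Reindexing along `n = n'` -/

/-- Transport of `QuadRel` along an equality of wire counts. [folklore] -/
theorem quadRel_reindex {n n' : ℕ} (h : n = n') {G : QReg n → ℂ} (hG : QuadRel G) :
    QuadRel (fun y : QReg n' => G (fun i => y (Fin.cast h i))) := by
  subst h
  exact hG

/-- Transport of `normSq` along an equality of wire counts. [folklore] -/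
theorem normSq_reindex {n n' : ℕ} (h : n = n') (G : QReg n → ℂ) :
    normSq (fun y : QReg n' => G (fun i => y (Fin.cast h i))) = normSq G := by
  subst h
  rfl

/-- Transport of the overlap along an equality of wire counts. [folklore] -/
theorem dotProduct_reindex {n n' : ℕ} (h : n = n') (ψ G : QReg n → ℂ) :
    star (fun y : QReg n' => ψ (fun i => y (Fin.cast h i))) ⬝ᵥ (fun y : QReg n' => G (fun i => y (Fin.cast h i))) =
      star ψ ⬝ᵥ G := by
  subst h
  rfl

/-! ### The induction: Gaussian fidelity of `|M⟩^{⊗t}` -/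

/-- The overlap with a tensor product with `|M⟩` on the last block:
`⟨ψ ⊗ M, G⟩ = (√2)⁻¹ (⟨ψ, G(·,0000)⟩ + ⟨ψ, G(·,1111)⟩)`. [folklore] -/
theorem star_tensorVec_magicM_dotProduct {b : ℕ} (ψ : QReg b → ℂ) (G : QReg (b + 4) → ℂ) :
    star (tensorVec ψ magicM) ⬝ᵥ G =
      ((Real.sqrt 2 : ℂ)⁻¹) * (star ψ ⬝ᵥ cond4 G s0000 + star ψ ⬝ᵥ cond4 G s1111) := by
  classical
  unfold dotProduct
  simp only [Pi.star_apply]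
  rw [← Fintype.sum_equiv (Fin.appendEquiv b 4) (fun p => star (tensorVec ψ magicM (Fin.append p.1 p.2)) *
      G (Fin.append p.1 p.2)) (fun z => star (tensorVec ψ magicM z) * G z) (fun p => rfl),
    Fintype.sum_prod_type, Finset.sum_comm]
  have htv : ∀ (w : QReg b) (x : QReg 4), tensorVec ψ magicM (Fin.append w x) = ψ w * magicM x := by
    intro w x
    unfold tensorVec
    congr 1
    · congr 1; funext i; exact Fin.append_left w x i
    · congr 1; funext j; exact Fin.append_right w x j
  simp_rw [htv]
  have hM : ∀ x : QReg 4, magicM x = if (x = s0000 ∨ x = s1111) then ((Real.sqrt 2 : ℂ)⁻¹) else 0 := by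
    intro x
    rw [magicM_apply]
    by_cases h : x = s0000 ∨ x = s1111
    · rw [if_pos h]
      rcases h with rfl | rfl <;> simp [s0000, s1111]
    · rw [if_neg h, if_neg]
      intro hall
      apply h
      cases hx : x 0
      · left; funext i; rw [hall i, hx]; rfl
      · right; funext i; rw [hall i, hx]; rfl
  have hne : s0000 ≠ s1111 := by decide
  rw [Finset.sum_eq_add s0000 s1111 hne]
  · have h0 : magicM s0000 = ((Real.sqrt 2 : ℂ)⁻¹) := by rw [hM, if_pos (Or.inl rfl)]
    have h1 : magicM s1111 = ((Real.sqrt 2 : ℂ)⁻¹) := by rw [hM, if_pos (Or.inr rfl)]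
    simp_rw [h0, h1]
    have hr : star ((Real.sqrt 2 : ℂ)⁻¹) = ((Real.sqrt 2 : ℂ)⁻¹) := by
      rw [Complex.star_def, map_inv₀, Complex.conj_ofReal]
    unfold cond4
    rw [mul_add, Finset.mul_sum, Finset.mul_sum]
    congr 1 <;> refine Finset.sum_congr rfl fun w _ => ?_ <;> rw [star_mul', hr] <;> ring
  · intro x _ hx
    have : magicM x = 0 := by rw [hM, if_neg (not_or.2 ⟨hx.1, hx.2⟩)]
    simp [this]
  · simp
  · simp

/-- **GAUSSIAN FIDELITY OF `|M⟩^{⊗t}` FOR QUADREL VECTORS**: `|⟨M^{⊗t}, G⟩| ≤ 2^{-t/2} ‖G‖` for every `G`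
satisfying the quadratic relations (induction on `t`: peel the last block with
`star_tensorVec_magicM_dotProduct`, apply the hypothesis to the two corner conditionals — which inherit
`QuadRel` — and close with the corner lemma). [cite: CudbyStrelchuk2023, Lemma 3] -/
theorem magicMPow_overlap_le (t : ℕ) : ∀ (G : QReg (t * 4) → ℂ), QuadRel G →
    ‖star (magicMPow t) ⬝ᵥ G‖ ≤ ((Real.sqrt 2)⁻¹) ^ t * Real.sqrt (normSq G) := by
  induction t with
  | zero =>
    intro G _
    rw [magicMPow_zero, pow_zero, one_mul]
    have huniv : (Finset.univ : Finset (QReg (0 * 4))) = {fun i => i.elim0} := by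
      ext x; simp only [Finset.mem_univ, Finset.mem_singleton, true_iff]; funext i; exact i.elim0
    unfold dotProduct normSq
    rw [huniv, Finset.sum_singleton, Finset.sum_singleton, Real.sqrt_sq (norm_nonneg _)]
    simp
  | succ t ih =>
    intro G hG
    have h : (t + 1) * 4 = t * 4 + 4 := add_one_mul t 4
    -- transport to `t * 4 + 4` wires
    set G' : QReg (t * 4 + 4) → ℂ := fun y => G (fun i => y (Fin.cast h i)) with hG'
    have hq' : QuadRel G' := quadRel_reindex h hG
    have hn' : normSq G' = normSq G := normSq_reindex h G
    have hov : star (magicMPow (t + 1)) ⬝ᵥ G = star (tensorVec (magicMPow t) magicM) ⬝ᵥ G' := by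
      have e : magicMPow (t + 1) = fun y : QReg ((t + 1) * 4) =>
          (tensorVec (magicMPow t) magicM) (fun i => y (Fin.cast h.symm i)) := by
        funext y
        rw [magicMPow_succ]
      have eG : G = fun y : QReg ((t + 1) * 4) => G' (fun i => y (Fin.cast h.symm i)) := by
        funext y
        rfl
      rw [e, eG]
      exact dotProduct_reindex h.symm (tensorVec (magicMPow t) magicM) G'
    rw [hov, star_tensorVec_magicM_dotProduct, ← hn']
    have ha := ih (cond4 G' s0000) (quadRel_cond4 hq' s0000)
    have hb := ih (cond4 G' s1111) (quadRel_cond4 hq' s1111)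
    have hc := corner_lemma hq'
    have hs : ‖((Real.sqrt 2 : ℂ)⁻¹)‖ = (Real.sqrt 2)⁻¹ := by
      rw [norm_inv, Complex.norm_real, Real.norm_eq_abs, abs_of_nonneg (Real.sqrt_nonneg 2)]
    have hs0 : 0 ≤ (Real.sqrt 2)⁻¹ := by positivity
    calc ‖((Real.sqrt 2 : ℂ)⁻¹) * (star (magicMPow t) ⬝ᵥ cond4 G' s0000 + star (magicMPow t) ⬝ᵥ cond4 G' s1111)‖
        ≤ (Real.sqrt 2)⁻¹ * (‖star (magicMPow t) ⬝ᵥ cond4 G' s0000‖ + ‖star (magicMPow t) ⬝ᵥ cond4 G' s1111‖) := by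
          rw [norm_mul, hs]
          exact mul_le_mul_of_nonneg_left (norm_add_le _ _) hs0
      _ ≤ (Real.sqrt 2)⁻¹ * (((Real.sqrt 2)⁻¹) ^ t * Real.sqrt (normSq (cond4 G' s0000)) +
          ((Real.sqrt 2)⁻¹) ^ t * Real.sqrt (normSq (cond4 G' s1111))) := by gcongr
      _ = ((Real.sqrt 2)⁻¹) ^ (t + 1) * (Real.sqrt (normSq (cond4 G' s0000)) +
          Real.sqrt (normSq (cond4 G' s1111))) := by ring
      _ ≤ ((Real.sqrt 2)⁻¹) ^ (t + 1) * Real.sqrt (normSq G') :=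
          mul_le_mul_of_nonneg_left hc (by positivity)

/-- **THE GAUSSIAN FIDELITY BOUND `F_𝒢(M^{⊗t}) ≤ 2^{-t}`** (CudbyStrelchuk2023 Lemma 3, here by the
corner-lemma induction from the annihilator definition): for every Gaussian `g` on `4t` qubits,
`|⟨M^{⊗t}, g⟩|² ≤ 2^{-t} ‖g‖²`. This DISCHARGES the hypothesis `hF` of
`Negative.not_polyCoeffThesis_of_fidelityBound` and makes `Disproof.MagicPowFidelityBound` a theorem.
[cite: CudbyStrelchuk2023, Lemma 3] -/
theorem magicPowFidelityBound_holds (t : ℕ) (g : QReg (t * 4) → ℂ) (hg : IsGaussian g) :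
    ‖star (magicMPow t) ⬝ᵥ g‖ ^ 2 ≤ ((1 : ℝ) / 2) ^ t * normSq g := by
  have h := magicMPow_overlap_le t g (IsGaussian.quadRel hg)
  have h2 := pow_le_pow_left₀ (norm_nonneg _) h 2
  rw [mul_pow, ← pow_mul, Real.sq_sqrt (normSq_nonneg' g)] at h2
  have hs : ((Real.sqrt 2)⁻¹) ^ (t * 2) = ((1 : ℝ) / 2) ^ t := by
    rw [mul_comm t 2, pow_mul, inv_pow, Real.sq_sqrt (by norm_num : (0 : ℝ) ≤ 2), one_div]
  rwa [hs] at h2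

end Summit.QuantumAdvantage.QuantumAdvantage.Cruxes.GaussRankPolyImpliesPPoly.Disproof
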